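import Literature.Topology.Immersions.HolonomicApproxDeriv
import Mathlib.Analysis.Calculus.MeanValue
import Mathlib.Topology.MetricSpace.ProperSpace
import HarnessLib

/-!
# Holonomic approximation over a cube of positive codimension (Eliashberg–Mishachev,
# Thm. 3.1.2, for `1`-jets): the estimates and the theorem

Topic `Literature/Topology/Immersions`; fourth file of the holonomic approximation engine behind
`Literature.Topology.Immersions.Phillips1967_exists_isLocalDiffeomorph_of_isParallelizable`.

**Theorem** (`holonomic_approx_cube`, our rendering of Eliashberg–Mishachev 2002, Thm. 3.1.2
with `K = [-1, 1]ᵏ × 0 ⊂ ℝⁿ`, `k < n`, `r = 1`, relative to `Op ∂K`). Let `f : ℝⁿ → G` and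
`A : ℝⁿ → L(ℝⁿ, G)` be smooth, and suppose the section `(f, A)` of the `1`-jet bundle is
holonomic (`Df = A`) on the part of the coordinate `k`-plane where some `|tᵢ| ≥ 1 - ρ`. Then for
every `ε > 0` there are a smooth `g : ℝⁿ → G`, a smooth shear `h : ℝⁿ → ℝⁿ` and an open set
`W ⊇ h(K)` such that `‖g - f‖ ≤ ε` and `‖Dg - A‖ ≤ ε` on `W`; `g = f` where some
`|tᵢ| ≥ 1 - ρ`; `h = id` where some `|tᵢ| ≥ 1 - ρ/4` or some normal `|z_l| ≥ 2`; `‖h - id‖ ≤ ε`;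
and `Dh` is everywhere invertible.

**Proof** (§§1–4): bounds `B, B', W₀, W'` for the defects and their tangential partials (they
only depend on the tangential coordinates, and vanish outside a compact part of the plane),
Lipschitz constants `L_f, L_A` of `Df, A` on a box; on the tube
`W = {|tᵢ| < 1 + ρ/4, |u - Θ(t)| < r, |z_l| < r}` the tangential defect `-bⱼ` hidden in
`Df(π z) - A(π z)` is cancelled **exactly** by the `[i = j] bᵢ` term of the key combination
(`HolonomicApproxDeriv.lean`), and every other term is `O(η) + O(a₀) + O(a₀/Λ) + O(1/Λ)`; the
parameters are chosen in the order `η`, `a₀`, `Λ`.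

## References

* Y. Eliashberg, N. Mishachev, *Introduction to the `h`-principle*, GSM 48 (2002), Thm. 3.1.1,
  Thm. 3.1.2, §§3.2–3.7. [EliashbergMishachev2002]
* M. Gromov, *Partial differential relations* (1986), 2.2.1. [Gromov1986PDR]
-/

open scoped Topology ContDiff
open Set Function Filter Real Metric

noncomputable section

namespace Literature.Topology.Immersions.HolonomicApprox

variable {n : ℕ} {G : Type*} [NormedAddCommGroup G] [NormedSpace ℝ G]

/-! ### §0 Boxes in `ℝⁿ` -/

/-- The closed coordinate box `{|z_l| ≤ R}` is compact. [folklore] -/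
theorem isCompact_box (R : ℝ) : IsCompact {z : EuclideanSpace ℝ (Fin n) | ∀ l, |z l| ≤ R} := by
  have h : {z : EuclideanSpace ℝ (Fin n) | ∀ l, |z l| ≤ R} =
      (EuclideanSpace.equiv (Fin n) ℝ) ⁻¹' (Set.pi univ fun _ => Icc (-R) R) := by
    ext z
    simp only [mem_setOf_eq, mem_preimage, mem_univ_pi, mem_Icc, abs_le]
    rfl
  rw [h]
  exact (EuclideanSpace.equiv (Fin n) ℝ).toHomeomorph.isCompact_preimage.2
    (isCompact_univ_pi fun _ => isCompact_Icc)

/-- The closed coordinate box is convex. [folklore] -/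
theorem convex_box (R : ℝ) : Convex ℝ {z : EuclideanSpace ℝ (Fin n) | ∀ l, |z l| ≤ R} := by
  have h : {z : EuclideanSpace ℝ (Fin n) | ∀ l, |z l| ≤ R} = ⋂ l, {z | |z l| ≤ R} := by
    ext z; simp
  rw [h]
  refine convex_iInter fun l => ?_
  have : {z : EuclideanSpace ℝ (Fin n) | |z l| ≤ R} =
      (EuclideanSpace.proj (𝕜 := ℝ) l) ⁻¹' Icc (-R) R := by
    ext z; simp [abs_le]
  rw [this]
  exact (convex_Icc _ _).linear_preimage _

namespace Setup

variable (S : Setup n G)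

/-! ### §1 Uniform bounds for the defects, their partials, and Lipschitz constants -/

/-- Points with all tangential coordinates `≤ 2` in absolute value project into the box.
[folklore] -/
theorem proj_mem_box {z : EuclideanSpace ℝ (Fin n)} (hz : ∀ j, |z (S.tang j)| ≤ 2) :
    S.proj z ∈ {p : EuclideanSpace ℝ (Fin n) | ∀ l, |p l| ≤ 2} := by
  intro l
  by_cases hl : S.IsNormal l
  · rw [S.proj_apply_of_isNormal z hl, abs_zero]; norm_num
  · have hlt : l.val < S.k := not_le.1 hl
    have hl' : l = S.tang ⟨l.val, hlt⟩ := Fin.ext (by simp)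
    rw [hl', S.proj_apply_tang]; exact hz _

/-- If some tangential coordinate exceeds `2 > 1 + ρ/2`, then `χ = 0` near `z`. [folklore] -/
theorem χ_eventuallyEq_zero {z : EuclideanSpace ℝ (Fin n)} (hz : ∃ j, 2 < |z (S.tang j)|) :
    S.χ =ᶠ[𝓝 z] fun _ => 0 := by
  obtain ⟨j, hj⟩ := hz
  have hopen : IsOpen {z' : EuclideanSpace ℝ (Fin n) | 1 + S.ρ / 2 < |z' (S.tang j)|} :=
    isOpen_lt continuous_const (continuous_abs.comp (contDiff_coord (m := 0) (S.tang j)).continuous)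
  have hz' : 1 + S.ρ / 2 < |z (S.tang j)| := by linarith [S.hρ1]
  filter_upwards [hopen.mem_nhds hz'] with z' hz''
  exact Finset.prod_eq_zero (Finset.mem_univ j) (plateau_eq_zero _ hz''.le)

/-- Auxiliary item `b_eventuallyEq_zero` of the explicit holonomic-approximation construction.
[cite: EliashbergMishachev2002, Thm. 3.1.2 (proof)] -/
theorem b_eventuallyEq_zero (i : Fin S.k) {z : EuclideanSpace ℝ (Fin n)} (hz : ∃ j, 2 < |z (S.tang j)|) :
    S.b i =ᶠ[𝓝 z] fun _ => 0 := by
  filter_upwards [S.χ_eventuallyEq_zero hz] with z' hz'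
  simp only [b, hz', zero_smul]

/-- Auxiliary item `w_eventuallyEq_zero` of the explicit holonomic-approximation construction.
[cite: EliashbergMishachev2002, Thm. 3.1.2 (proof)] -/
theorem w_eventuallyEq_zero (l : Fin n) {z : EuclideanSpace ℝ (Fin n)} (hz : ∃ j, 2 < |z (S.tang j)|) :
    S.w l =ᶠ[𝓝 z] fun _ => 0 := by
  filter_upwards [S.χ_eventuallyEq_zero hz] with z' hz'
  simp only [w, hz', zero_smul]

/-- **A uniform bound for the tangential defects.** [folklore] -/
theorem exists_bound_b {S : Setup n G} (hf : ContDiff ℝ ∞ S.f) (hA : ContDiff ℝ ∞ S.A) :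
    ∃ B : ℝ, 0 ≤ B ∧ ∀ i z, ‖S.b i z‖ ≤ B := by
  have hcont : ∀ i : Fin S.k, Continuous fun p => S.A p (eV (S.tang i)) - fderiv ℝ S.f p (eV (S.tang i)) :=
    fun i => ((hA.continuous).clm_apply continuous_const).sub
      ((hf.continuous_fderiv (by simp)).clm_apply continuous_const)
  have hbd : ∀ i : Fin S.k, ∃ C, ∀ p ∈ {p : EuclideanSpace ℝ (Fin n) | ∀ l, |p l| ≤ 2},
      ‖S.A p (eV (S.tang i)) - fderiv ℝ S.f p (eV (S.tang i))‖ ≤ C :=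
    fun i => (isCompact_box 2).exists_bound_of_continuousOn (hcont i).continuousOn
  choose C hC using hbd
  refine ⟨∑ i, |C i|, Finset.sum_nonneg fun i _ => abs_nonneg _, fun i z => ?_⟩
  have hle : |C i| ≤ ∑ i, |C i| := Finset.single_le_sum (f := fun i => |C i|) (fun i _ => abs_nonneg _)
    (Finset.mem_univ i)
  by_cases hz : ∀ j, |z (S.tang j)| ≤ 2
  · calc ‖S.b i z‖ = |S.χ z| * ‖S.A (S.proj z) (eV (S.tang i)) - fderiv ℝ S.f (S.proj z) (eV (S.tang i))‖ := by
          rw [b, norm_smul, Real.norm_eq_abs]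
      _ ≤ 1 * |C i| := mul_le_mul (by rw [abs_of_nonneg (S.χ_nonneg z)]; exact S.χ_le_one z)
          ((hC i _ (S.proj_mem_box hz)).trans (le_abs_self _)) (norm_nonneg _) zero_le_one
      _ ≤ ∑ i, |C i| := by rw [one_mul]; exact hle
  · push Not at hz
    obtain ⟨j, hj⟩ := hz
    have : S.b i z = 0 := (S.b_eventuallyEq_zero i ⟨j, hj⟩).self_of_nhds
    rw [this, norm_zero]; exact Finset.sum_nonneg fun i _ => abs_nonneg _

/-- **A uniform bound for the normal defects.** [folklore] -/
theorem exists_bound_w {S : Setup n G} (hf : ContDiff ℝ ∞ S.f) (hA : ContDiff ℝ ∞ S.A) :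
    ∃ B : ℝ, 0 ≤ B ∧ ∀ l z, ‖S.w l z‖ ≤ B := by
  have hcont : ∀ l : Fin n, Continuous fun p => S.A p (eV l) - fderiv ℝ S.f p (eV l) :=
    fun l => ((hA.continuous).clm_apply continuous_const).sub
      ((hf.continuous_fderiv (by simp)).clm_apply continuous_const)
  have hbd : ∀ l : Fin n, ∃ C, ∀ p ∈ {p : EuclideanSpace ℝ (Fin n) | ∀ l, |p l| ≤ 2},
      ‖S.A p (eV l) - fderiv ℝ S.f p (eV l)‖ ≤ C :=
    fun l => (isCompact_box 2).exists_bound_of_continuousOn (hcont l).continuousOn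
  choose C hC using hbd
  refine ⟨∑ l, |C l|, Finset.sum_nonneg fun l _ => abs_nonneg _, fun l z => ?_⟩
  have hle : |C l| ≤ ∑ l, |C l| := Finset.single_le_sum (f := fun l => |C l|) (fun l _ => abs_nonneg _)
    (Finset.mem_univ l)
  by_cases hz : ∀ j, |z (S.tang j)| ≤ 2
  · calc ‖S.w l z‖ = |S.χ z| * ‖S.A (S.proj z) (eV l) - fderiv ℝ S.f (S.proj z) (eV l)‖ := by
          rw [w, norm_smul, Real.norm_eq_abs]
      _ ≤ 1 * |C l| := mul_le_mul (by rw [abs_of_nonneg (S.χ_nonneg z)]; exact S.χ_le_one z)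
          ((hC l _ (S.proj_mem_box hz)).trans (le_abs_self _)) (norm_nonneg _) zero_le_one
      _ ≤ ∑ l, |C l| := by rw [one_mul]; exact hle
  · push Not at hz
    obtain ⟨j, hj⟩ := hz
    have : S.w l z = 0 := (S.w_eventuallyEq_zero l ⟨j, hj⟩).self_of_nhds
    rw [this, norm_zero]; exact Finset.sum_nonneg fun l _ => abs_nonneg _

/-- **A uniform bound for the tangential partials of the tangential defects.** [folklore] -/
theorem exists_bound_fderiv_b {S : Setup n G} (hf : ContDiff ℝ ∞ S.f) (hA : ContDiff ℝ ∞ S.A) :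
    ∃ B' : ℝ, 0 ≤ B' ∧ ∀ i j z, ‖fderiv ℝ (S.b i) z (eV (S.tang j))‖ ≤ B' := by
  have hcont : ∀ i : Fin S.k, Continuous (fderiv ℝ (S.b i)) :=
    fun i => (contDiff_b hf hA i).continuous_fderiv (by simp)
  have hbd : ∀ i : Fin S.k, ∃ C, ∀ p ∈ {p : EuclideanSpace ℝ (Fin n) | ∀ l, |p l| ≤ 2},
      ‖fderiv ℝ (S.b i) p‖ ≤ C :=
    fun i => (isCompact_box 2).exists_bound_of_continuousOn (hcont i).continuousOn
  choose C hC using hbd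
  refine ⟨∑ i, |C i|, Finset.sum_nonneg fun i _ => abs_nonneg _, fun i j z => ?_⟩
  have hle : |C i| ≤ ∑ i, |C i| := Finset.single_le_sum (f := fun i => |C i|) (fun i _ => abs_nonneg _)
    (Finset.mem_univ i)
  rw [fderiv_b_apply_eV_tang hf hA i j z]
  by_cases hz : ∀ j, |z (S.tang j)| ≤ 2
  · calc ‖fderiv ℝ (S.b i) (S.proj z) (eV (S.tang j))‖
          ≤ ‖fderiv ℝ (S.b i) (S.proj z)‖ * ‖(eV (S.tang j) : EuclideanSpace ℝ (Fin n))‖ :=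
            ContinuousLinearMap.le_opNorm _ _
      _ ≤ |C i| * 1 := by
            rw [norm_eV]
            exact mul_le_mul_of_nonneg_right ((hC i _ (S.proj_mem_box hz)).trans (le_abs_self _))
              zero_le_one
      _ ≤ ∑ i, |C i| := by rw [mul_one]; exact hle
  · push Not at hz
    obtain ⟨j', hj'⟩ := hz
    have hev : S.b i =ᶠ[𝓝 (S.proj z)] fun _ => 0 :=
      S.b_eventuallyEq_zero i ⟨j', by rwa [S.proj_apply_tang]⟩
    rw [hev.fderiv_eq, fderiv_const_apply]
    simp only [FunLike.coe_zero, Pi.zero_apply, norm_zero]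
    exact Finset.sum_nonneg fun i _ => abs_nonneg _

/-- **A uniform bound for the tangential partials of the normal defects.** [folklore] -/
theorem exists_bound_fderiv_w {S : Setup n G} (hf : ContDiff ℝ ∞ S.f) (hA : ContDiff ℝ ∞ S.A) :
    ∃ W' : ℝ, 0 ≤ W' ∧ ∀ l j z, ‖fderiv ℝ (S.w l) z (eV (S.tang j))‖ ≤ W' := by
  have hcont : ∀ l : Fin n, Continuous (fderiv ℝ (S.w l)) :=
    fun l => (contDiff_w hf hA l).continuous_fderiv (by simp)
  have hbd : ∀ l : Fin n, ∃ C, ∀ p ∈ {p : EuclideanSpace ℝ (Fin n) | ∀ l, |p l| ≤ 2},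
      ‖fderiv ℝ (S.w l) p‖ ≤ C :=
    fun l => (isCompact_box 2).exists_bound_of_continuousOn (hcont l).continuousOn
  choose C hC using hbd
  refine ⟨∑ l, |C l|, Finset.sum_nonneg fun l _ => abs_nonneg _, fun l j z => ?_⟩
  have hle : |C l| ≤ ∑ l, |C l| := Finset.single_le_sum (f := fun l => |C l|) (fun l _ => abs_nonneg _)
    (Finset.mem_univ l)
  rw [fderiv_w_apply_eV_tang hf hA l j z]
  by_cases hz : ∀ j, |z (S.tang j)| ≤ 2
  · calc ‖fderiv ℝ (S.w l) (S.proj z) (eV (S.tang j))‖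
          ≤ ‖fderiv ℝ (S.w l) (S.proj z)‖ * ‖(eV (S.tang j) : EuclideanSpace ℝ (Fin n))‖ :=
            ContinuousLinearMap.le_opNorm _ _
      _ ≤ |C l| * 1 := by
            rw [norm_eV]
            exact mul_le_mul_of_nonneg_right ((hC l _ (S.proj_mem_box hz)).trans (le_abs_self _))
              zero_le_one
      _ ≤ ∑ l, |C l| := by rw [mul_one]; exact hle
  · push Not at hz
    obtain ⟨j', hj'⟩ := hz
    have hev : S.w l =ᶠ[𝓝 (S.proj z)] fun _ => 0 :=
      S.w_eventuallyEq_zero l ⟨j', by rwa [S.proj_apply_tang]⟩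
    rw [hev.fderiv_eq, fderiv_const_apply]
    simp only [FunLike.coe_zero, Pi.zero_apply, norm_zero]
    exact Finset.sum_nonneg fun l _ => abs_nonneg _

/-- **Lipschitz bounds across the plane on the box `{|z_l| ≤ 2}`**: for a `C²`-map `F`
(applied to `F = Df` and `F = A`) there is `L ≥ 0` with `‖F z - F (π z)‖ ≤ L ‖z - π z‖` for
all `z` in the box (mean value inequality on the convex box, where `DF` is bounded).
[folklore] -/
theorem exists_lipschitz_proj {F' : Type*} [NormedAddCommGroup F'] [NormedSpace ℝ F']
    {F : EuclideanSpace ℝ (Fin n) → F'} (hF : ContDiff ℝ 1 F) :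
    ∃ L : ℝ, 0 ≤ L ∧ ∀ z ∈ {p : EuclideanSpace ℝ (Fin n) | ∀ l, |p l| ≤ 2},
      (∀ j, |z (S.tang j)| ≤ 2) → ‖F z - F (S.proj z)‖ ≤ L * ‖z - S.proj z‖ := by
  have hcont : Continuous (fderiv ℝ F) := hF.continuous_fderiv (by simp)
  obtain ⟨C, hC⟩ := (isCompact_box (n := n) 2).exists_bound_of_continuousOn hcont.continuousOn
  refine ⟨max C 0, le_max_right _ _, fun z hz hzt => ?_⟩
  have h := (convex_box (n := n) 2).norm_image_sub_le_of_norm_fderiv_le (f := F) (C := max C 0)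
    (fun p _ => (hF.differentiable (by simp)) p) (fun p hp => (hC p hp).trans (le_max_left _ _))
    (S.proj_mem_box hzt) hz
  exact h

/-! ### §2 Parameters, the tube, and elementary facts on it -/

/-- Positivity of the parameters (`η ≤ 1`). [cite: EliashbergMishachev2002, Thm. 3.1.2 (proof)] -/
structure Params : Prop where
  ha₀ : 0 < S.a₀
  hη : 0 < S.η
  hη1 : S.η ≤ 1
  hΛ : 0 < S.Λ

/-- The tube radius `r = a₀ ηᵏ` (below every amplitude tail).
[cite: EliashbergMishachev2002, Thm. 3.1.2 (proof)] -/
def r : ℝ := S.a₀ * S.η ^ S.k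

/-- **The tube** around the wiggled cube: tangential coordinates within `1 + ρ/4`, the wiggle
coordinate within `r` of `Θ(t)`, the other normal coordinates within `r` of `0`.
[cite: EliashbergMishachev2002, Thm. 3.1.2 (proof)] -/
def InTube (z : EuclideanSpace ℝ (Fin n)) : Prop :=
  (∀ j, |z (S.tang j)| < 1 + S.ρ / 4) ∧ |z S.κ - S.Θtot z| < S.r ∧
    ∀ l, S.IsNormal l → l ≠ S.κ → |z l| < S.r

section ParamFacts

variable {S} (hP : S.Params)
include hP

/-- Positivity of `a`. [folklore] -/
theorem a_pos (i : Fin S.k) : 0 < S.a i := mul_pos hP.ha₀ (pow_pos hP.hη _)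

/-- Elementary inequality between the parameters/quantities `a` and `a₀`. [folklore] -/
theorem a_le_a₀ (i : Fin S.k) : S.a i ≤ S.a₀ := by
  unfold a; exact mul_le_of_le_one_right hP.ha₀.le (pow_le_one₀ hP.hη.le hP.hη1)

/-- Elementary inequality between the parameters/quantities `ηpow` and `one`. [folklore] -/
theorem ηpow_le_one (m : ℕ) : S.η ^ m ≤ 1 := pow_le_one₀ hP.hη.le hP.hη1

/-- Elementary inequality between the parameters/quantities `ηpow` and `ηpow`. [folklore] -/
theorem ηpow_le_ηpow {m m' : ℕ} (h : m ≤ m') : S.η ^ m' ≤ S.η ^ m :=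
  pow_le_pow_of_le_one hP.hη.le hP.hη1 h

/-- Positivity of `N`. [folklore] -/
theorem N_pos (i : Fin S.k) : 0 < S.N i := by
  unfold N; exact div_pos (mul_pos hP.hΛ (inv_pos.2 (pow_pos hP.hη _))) hP.ha₀

/-- Auxiliary item `a_mul_N` of the explicit holonomic-approximation construction. [cite:
EliashbergMishachev2002, Thm. 3.1.2 (proof)] -/
theorem a_mul_N (i : Fin S.k) : S.a i * S.N i = S.Λ / S.η ^ (i : ℕ) := by
  unfold a N
  have hη := hP.hη.ne'
  have ha := hP.ha₀.ne'
  rw [pow_mul]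
  field_simp
  ring

/-- Auxiliary item `one_div_N` of the explicit holonomic-approximation construction. [cite:
EliashbergMishachev2002, Thm. 3.1.2 (proof)] -/
theorem one_div_N (i : Fin S.k) : 1 / S.N i = S.a₀ * S.η ^ (2 * (i : ℕ)) / S.Λ := by
  unfold N
  have hη := hP.hη.ne'
  have ha := hP.ha₀.ne'
  have hΛ := hP.hΛ.ne'
  field_simp

/-- Auxiliary item `one_div_N_le` of the explicit holonomic-approximation construction. [cite:
EliashbergMishachev2002, Thm. 3.1.2 (proof)] -/
theorem one_div_N_le (i : Fin S.k) : 1 / S.N i ≤ S.a₀ / S.Λ := by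
  rw [one_div_N hP]
  exact div_le_div_of_nonneg_right (mul_le_of_le_one_right hP.ha₀.le (ηpow_le_one hP _)) hP.hΛ.le

/-- Auxiliary item `two_div_aN` of the explicit holonomic-approximation construction. [cite:
EliashbergMishachev2002, Thm. 3.1.2 (proof)] -/
theorem two_div_aN (i : Fin S.k) : 2 / (S.a i * S.N i) = 2 * S.η ^ (i : ℕ) / S.Λ := by
  rw [a_mul_N hP]
  have hΛ := hP.hΛ.ne'
  field_simp

/-- Auxiliary item `two_div_aN_le` of the explicit holonomic-approximation construction. [cite:
EliashbergMishachev2002, Thm. 3.1.2 (proof)] -/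
theorem two_div_aN_le (i : Fin S.k) : 2 / (S.a i * S.N i) ≤ 2 / S.Λ := by
  rw [two_div_aN hP]
  apply div_le_div_of_nonneg_right _ hP.hΛ.le
  nlinarith [ηpow_le_one hP (i : ℕ)]

/-- The ratio of the slopes: `(a_{i₀}N_{i₀})/(aᵢNᵢ) = η^{i - i₀}` for `i₀ ≤ i`. [folklore] -/
theorem aN_div_aN {i₀ i : Fin S.k} (h : i₀ ≤ i) :
    S.a i₀ * S.N i₀ / (S.a i * S.N i) = S.η ^ ((i : ℕ) - (i₀ : ℕ)) := by
  rw [a_mul_N hP, a_mul_N hP]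
  have hΛ := hP.hΛ.ne'
  have hηi : S.η ^ (i : ℕ) ≠ 0 := pow_ne_zero _ hP.hη.ne'
  have hηi₀ : S.η ^ (i₀ : ℕ) ≠ 0 := pow_ne_zero _ hP.hη.ne'
  rw [div_div_div_cancel_left' _ _ hΛ, div_eq_iff hηi₀, ← pow_add,
    Nat.sub_add_cancel (by exact_mod_cast h)]

/-- Auxiliary item `aN_div_aN_le` of the explicit holonomic-approximation construction. [cite:
EliashbergMishachev2002, Thm. 3.1.2 (proof)] -/
theorem aN_div_aN_le {i₀ i : Fin S.k} (h : i₀ < i) :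
    S.a i₀ * S.N i₀ / (S.a i * S.N i) ≤ S.η := by
  rw [aN_div_aN hP h.le]
  have h1 : 1 ≤ (i : ℕ) - (i₀ : ℕ) := by
    have : (i₀ : ℕ) < (i : ℕ) := h
    omega
  calc S.η ^ ((i : ℕ) - (i₀ : ℕ)) ≤ S.η ^ 1 := ηpow_le_ηpow hP h1
    _ = S.η := pow_one _

/-- Positivity of `r`. [folklore] -/
theorem r_pos : 0 < S.r := mul_pos hP.ha₀ (pow_pos hP.hη _)

/-- Auxiliary item `r_le` of the explicit holonomic-approximation construction. [cite:
EliashbergMishachev2002, Thm. 3.1.2 (proof)] -/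
theorem r_le (i : Fin S.k) : S.r ≤ S.a₀ * S.η ^ ((i : ℕ) + 1) :=
  mul_le_mul_of_nonneg_left (ηpow_le_ηpow hP (by omega)) hP.ha₀.le

/-- Elementary inequality between the parameters/quantities `r` and `a₀`. [folklore] -/
theorem r_le_a₀ : S.r ≤ S.a₀ := mul_le_of_le_one_right hP.ha₀.le (ηpow_le_one hP _)

/-- `|θ_l| ≤ a_l`. [folklore] -/
theorem abs_θ_le (l : Fin S.k) (z : EuclideanSpace ℝ (Fin n)) : |S.θ l z| ≤ S.a l := by
  unfold θ
  rw [abs_mul, abs_mul, abs_of_pos (a_pos hP l)]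
  calc S.a l * |S.β z| * |Real.sin (S.N l * z (S.tang l))| ≤ S.a l * 1 * 1 :=
        mul_le_mul (mul_le_mul_of_nonneg_left (S.abs_β_le_one z) (a_pos hP l).le)
          (Real.abs_sin_le_one _) (abs_nonneg _) (by rw [mul_one]; exact (a_pos hP l).le)
    _ = S.a l := by ring

/-- `|Θ| ≤ k a₀`. [folklore] -/
theorem abs_Θtot_le (z : EuclideanSpace ℝ (Fin n)) : |S.Θtot z| ≤ S.k * S.a₀ := by
  unfold Θtot
  calc |∑ l : Fin S.k, S.θ l z| ≤ ∑ l : Fin S.k, |S.θ l z| := Finset.abs_sum_le_sum_abs _ _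
    _ ≤ ∑ _l : Fin S.k, S.a₀ := Finset.sum_le_sum fun l _ => (abs_θ_le hP l z).trans (a_le_a₀ hP l)
    _ = S.k * S.a₀ := by simp

/-- `|Θ - Θᵢ| ≤ k a₀ η^{i+1}` (only wiggles of smaller amplitude remain). [folklore] -/
theorem abs_Θtot_sub_Θ_le (i : Fin S.k) (z : EuclideanSpace ℝ (Fin n)) :
    |S.Θtot z - S.Θ i z| ≤ S.k * (S.a₀ * S.η ^ ((i : ℕ) + 1)) := by
  have hsplit : S.Θtot z - S.Θ i z = ∑ l ∈ Finset.univ.filter (fun l : Fin S.k => ¬ l ≤ i), S.θ l z := by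
    unfold Θtot Θ
    rw [← Finset.sum_filter_add_sum_filter_not Finset.univ (fun l : Fin S.k => l ≤ i)]
    ring
  rw [hsplit]
  calc |∑ l ∈ Finset.univ.filter (fun l : Fin S.k => ¬ l ≤ i), S.θ l z|
      ≤ ∑ l ∈ Finset.univ.filter (fun l : Fin S.k => ¬ l ≤ i), |S.θ l z| := Finset.abs_sum_le_sum_abs _ _
    _ ≤ ∑ l ∈ Finset.univ.filter (fun l : Fin S.k => ¬ l ≤ i), S.a₀ * S.η ^ ((i : ℕ) + 1) := by
        refine Finset.sum_le_sum fun l hl => (abs_θ_le hP l z).trans ?_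
        have hl' : (i : ℕ) + 1 ≤ (l : ℕ) := by
          have : ¬ l ≤ i := (Finset.mem_filter.1 hl).2
          have : i < l := not_le.1 this
          exact this
        exact mul_le_mul_of_nonneg_left (ηpow_le_ηpow hP hl') hP.ha₀.le
    _ ≤ ∑ _l : Fin S.k, S.a₀ * S.η ^ ((i : ℕ) + 1) :=
        Finset.sum_le_sum_of_subset_of_nonneg (Finset.filter_subset _ _) fun l _ _ =>
          mul_nonneg hP.ha₀.le (pow_nonneg hP.hη.le _)
    _ = S.k * (S.a₀ * S.η ^ ((i : ℕ) + 1)) := by simp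

end ParamFacts

section TubeFacts

variable {S} (hP : S.Params) {z : EuclideanSpace ℝ (Fin n)} (hz : S.InTube z)
include hP hz

omit hP in
/-- Where the cutoff `χ` equals `1`. [folklore] -/
theorem χ_eq_one_of_inTube : S.χ z = 1 := S.χ_eq_one fun j => (hz.1 j).le

/-- In the tube, `|u - Θᵢ| ≤ (k + 1) a₀ η^{i+1}`. [folklore] -/
theorem abs_κ_sub_Θ_le (i : Fin S.k) : |z S.κ - S.Θ i z| ≤ (S.k + 1) * (S.a₀ * S.η ^ ((i : ℕ) + 1)) := by
  have h1 : |z S.κ - S.Θtot z| ≤ S.a₀ * S.η ^ ((i : ℕ) + 1) := (hz.2.1).le.trans (r_le hP i)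
  have h2 := abs_Θtot_sub_Θ_le hP i z
  calc |z S.κ - S.Θ i z| = |(z S.κ - S.Θtot z) + (S.Θtot z - S.Θ i z)| := by ring_nf
    _ ≤ |z S.κ - S.Θtot z| + |S.Θtot z - S.Θ i z| := abs_add_le _ _
    _ ≤ S.a₀ * S.η ^ ((i : ℕ) + 1) + S.k * (S.a₀ * S.η ^ ((i : ℕ) + 1)) := add_le_add h1 h2
    _ = (S.k + 1) * (S.a₀ * S.η ^ ((i : ℕ) + 1)) := by ring

/-- In the tube, `|u| ≤ (k + 1) a₀`. [folklore] -/
theorem abs_κ_le : |z S.κ| ≤ (S.k + 1) * S.a₀ := by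
  have h1 : |z S.κ - S.Θtot z| ≤ S.a₀ := (hz.2.1).le.trans (r_le_a₀ hP)
  have h2 := abs_Θtot_le hP z
  calc |z S.κ| = |(z S.κ - S.Θtot z) + S.Θtot z| := by ring_nf
    _ ≤ |z S.κ - S.Θtot z| + |S.Θtot z| := abs_add_le _ _
    _ ≤ S.a₀ + S.k * S.a₀ := add_le_add h1 h2
    _ = (S.k + 1) * S.a₀ := by ring

/-- In the tube, every normal coordinate is `≤ (k + 1) a₀` in absolute value. [folklore] -/
theorem abs_normal_le {l : Fin n} (hl : S.IsNormal l) : |z l| ≤ (S.k + 1) * S.a₀ := by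
  by_cases h : l = S.κ
  · subst h; exact abs_κ_le hP hz
  · have := (hz.2.2 l hl h).le.trans (r_le_a₀ hP)
    have hk : (0 : ℝ) ≤ S.k := Nat.cast_nonneg _
    nlinarith [hP.ha₀]

/-- In the tube (with `(k + 1) a₀ ≤ 1`), all coordinates of `z` are `≤ 2` in absolute value.
[folklore] -/
theorem mem_box_of_inTube (hsmall : (S.k + 1) * S.a₀ ≤ 1) :
    z ∈ {p : EuclideanSpace ℝ (Fin n) | ∀ l, |p l| ≤ 2} := by
  intro l
  by_cases hl : S.IsNormal l
  · exact (abs_normal_le hP hz hl).trans (hsmall.trans (by norm_num))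
  · have hlt : l.val < S.k := not_le.1 hl
    have hl' : l = S.tang ⟨l.val, hlt⟩ := Fin.ext (by simp)
    rw [hl']
    have := hz.1 ⟨l.val, hlt⟩
    linarith [S.hρ1]

omit hP in
/-- Absolute-value estimate for `tang`. [cite: EliashbergMishachev2002, Thm. 3.1.2 (proof)] -/
theorem abs_tang_le_two (j : Fin S.k) : |z (S.tang j)| ≤ 2 := by
  have := hz.1 j; linarith [S.hρ1]

/-- In the tube, `‖z - π z‖ ≤ (n (k + 1)) a₀` (at most `n` normal coordinates, each
`≤ (k + 1) a₀`). [folklore] -/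
theorem norm_sub_proj_le : ‖z - S.proj z‖ ≤ n * ((S.k + 1) * S.a₀) := by
  have hcoord : ∀ l, |(z - S.proj z) l| ≤ (S.k + 1) * S.a₀ := by
    intro l
    rw [PiLp.sub_apply]
    by_cases hl : S.IsNormal l
    · rw [S.proj_apply_of_isNormal z hl, sub_zero]; exact abs_normal_le hP hz hl
    · have hlt : l.val < S.k := not_le.1 hl
      have hl' : l = S.tang ⟨l.val, hlt⟩ := Fin.ext (by simp)
      rw [hl', S.proj_apply_tang, sub_self, abs_zero]
      have hk : (0 : ℝ) ≤ S.k := Nat.cast_nonneg _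
      nlinarith [hP.ha₀]
  calc ‖z - S.proj z‖ = ‖∑ l, (z - S.proj z) l • (eV l : EuclideanSpace ℝ (Fin n))‖ := by
        rw [sum_apply_smul_eV]
    _ ≤ ∑ l, ‖(z - S.proj z) l • (eV l : EuclideanSpace ℝ (Fin n))‖ := norm_sum_le _ _
    _ = ∑ l, |(z - S.proj z) l| := by simp [norm_smul]
    _ ≤ ∑ _l : Fin n, (S.k + 1) * S.a₀ := Finset.sum_le_sum fun l _ => hcoord l
    _ = n * ((S.k + 1) * S.a₀) := by simp

end TubeFacts

/-! ### §3 The error estimates on the tube -/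

section Estimates

variable {S} (hP : S.Params) {z : EuclideanSpace ℝ (Fin n)} (hz : S.InTube z)
  (hsmall : (S.k + 1) * S.a₀ ≤ 1)
include hP hz hsmall

/-- The Lipschitz term for `Df`. [folklore] -/
theorem lip_f_le {Lf : ℝ} (hLf0 : 0 ≤ Lf)
    (hLf : ∀ z ∈ {p : EuclideanSpace ℝ (Fin n) | ∀ l, |p l| ≤ 2},
      (∀ j, |z (S.tang j)| ≤ 2) → ‖fderiv ℝ S.f z - fderiv ℝ S.f (S.proj z)‖ ≤ Lf * ‖z - S.proj z‖)
    (v : EuclideanSpace ℝ (Fin n)) (hv : ‖v‖ ≤ 1) :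
    ‖fderiv ℝ S.f z v - fderiv ℝ S.f (S.proj z) v‖ ≤ Lf * (n * ((S.k + 1) * S.a₀)) := by
  have heq : fderiv ℝ S.f z v - fderiv ℝ S.f (S.proj z) v = (fderiv ℝ S.f z - fderiv ℝ S.f (S.proj z)) v := by
    simp only [FunLike.coe_sub, Pi.sub_apply]
  rw [heq]
  calc ‖(fderiv ℝ S.f z - fderiv ℝ S.f (S.proj z)) v‖
      ≤ ‖fderiv ℝ S.f z - fderiv ℝ S.f (S.proj z)‖ * ‖v‖ := ContinuousLinearMap.le_opNorm _ _
    _ ≤ Lf * ‖z - S.proj z‖ * 1 :=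
        mul_le_mul (hLf z (mem_box_of_inTube hP hz hsmall) (fun j => abs_tang_le_two hz j)) hv
          (norm_nonneg _) (mul_nonneg hLf0 (norm_nonneg _))
    _ ≤ Lf * (n * ((S.k + 1) * S.a₀)) := by
        rw [mul_one]; exact mul_le_mul_of_nonneg_left (norm_sub_proj_le hP hz) hLf0

/-- The Lipschitz term for `A`. [folklore] -/
theorem lip_A_le {LA : ℝ} (hLA0 : 0 ≤ LA)
    (hLA : ∀ z ∈ {p : EuclideanSpace ℝ (Fin n) | ∀ l, |p l| ≤ 2},
      (∀ j, |z (S.tang j)| ≤ 2) → ‖S.A z - S.A (S.proj z)‖ ≤ LA * ‖z - S.proj z‖)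
    (v : EuclideanSpace ℝ (Fin n)) (hv : ‖v‖ ≤ 1) :
    ‖S.A (S.proj z) v - S.A z v‖ ≤ LA * (n * ((S.k + 1) * S.a₀)) := by
  have heq : S.A (S.proj z) v - S.A z v = -((S.A z - S.A (S.proj z)) v) := by
    simp only [FunLike.coe_sub, Pi.sub_apply, neg_sub]
  rw [heq, norm_neg]
  calc ‖(S.A z - S.A (S.proj z)) v‖ ≤ ‖S.A z - S.A (S.proj z)‖ * ‖v‖ := ContinuousLinearMap.le_opNorm _ _
    _ ≤ LA * ‖z - S.proj z‖ * 1 :=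
        mul_le_mul (hLA z (mem_box_of_inTube hP hz hsmall) (fun j => abs_tang_le_two hz j)) hv
          (norm_nonneg _) (mul_nonneg hLA0 (norm_nonneg _))
    _ ≤ LA * (n * ((S.k + 1) * S.a₀)) := by
        rw [mul_one]; exact mul_le_mul_of_nonneg_left (norm_sub_proj_le hP hz) hLA0

omit hsmall in
/-- The normal-coordinate sum `Σ_{l ≥ k} z_l ∂ⱼw_l`. [folklore] -/
theorem normal_sum_le {W' : ℝ} (hW'0 : 0 ≤ W')
    (hW' : ∀ l j z, ‖fderiv ℝ (S.w l) z (eV (S.tang j))‖ ≤ W') (j : Fin S.k) :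
    ‖∑ l ∈ Finset.univ.filter (fun l : Fin n => S.IsNormal l), z l • fderiv ℝ (S.w l) z (eV (S.tang j))‖ ≤
      n * ((S.k + 1) * S.a₀) * W' := by
  calc ‖∑ l ∈ Finset.univ.filter (fun l : Fin n => S.IsNormal l), z l • fderiv ℝ (S.w l) z (eV (S.tang j))‖
      ≤ ∑ l ∈ Finset.univ.filter (fun l : Fin n => S.IsNormal l), ‖z l • fderiv ℝ (S.w l) z (eV (S.tang j))‖ :=
        norm_sum_le _ _
    _ ≤ ∑ l ∈ Finset.univ.filter (fun l : Fin n => S.IsNormal l), (S.k + 1) * S.a₀ * W' := by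
        refine Finset.sum_le_sum fun l hl => ?_
        rw [norm_smul, Real.norm_eq_abs]
        have hk : (0:ℝ) ≤ S.k := Nat.cast_nonneg _
        exact mul_le_mul (abs_normal_le hP hz (Finset.mem_filter.1 hl).2) (hW' l j z) (norm_nonneg _)
          (mul_nonneg (by linarith) hP.ha₀.le)
    _ ≤ ∑ _l : Fin n, (S.k + 1) * S.a₀ * W' :=
        Finset.sum_le_sum_of_subset_of_nonneg (Finset.filter_subset _ _) fun l _ _ => by
          have hk : (0:ℝ) ≤ S.k := Nat.cast_nonneg _
          exact mul_nonneg (mul_nonneg (by linarith) hP.ha₀.le) hW'0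
    _ = n * ((S.k + 1) * S.a₀) * W' := by
        simp only [Finset.sum_const, Finset.card_univ, Fintype.card_fin, nsmul_eq_mul]; ring

omit hsmall in
/-- The terms `(u - Θᵢ) ∂ⱼcᵢ`. [folklore] -/
theorem T4_le {B B' : ℝ} (hB : ∀ i z, ‖S.b i z‖ ≤ B)
    (hB'0 : 0 ≤ B') (hB' : ∀ i j z, ‖fderiv ℝ (S.b i) z (eV (S.tang j))‖ ≤ B') (i₀ : Fin S.k) :
    ‖∑ i : Fin S.k, (z S.κ - S.Θ i z) •
        ((if i = i₀ then 2 / S.a i * Real.sin (S.N i * z (S.tang i)) else 0) • S.b i z +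
          (-(2 / (S.a i * S.N i)) * Real.cos (S.N i * z (S.tang i))) • fderiv ℝ (S.b i) z (eV (S.tang i₀)))‖ ≤
      2 * (S.k + 1) * B * S.η + 2 * S.k * (S.k + 1) * S.a₀ * B' / S.Λ := by
  have hk : (0:ℝ) ≤ S.k := Nat.cast_nonneg _
  have ha₀ := hP.ha₀.le
  have hΛ := hP.hΛ
  -- each term
  have hterm : ∀ i : Fin S.k, ‖(z S.κ - S.Θ i z) •
      ((if i = i₀ then 2 / S.a i * Real.sin (S.N i * z (S.tang i)) else 0) • S.b i z +
        (-(2 / (S.a i * S.N i)) * Real.cos (S.N i * z (S.tang i))) • fderiv ℝ (S.b i) z (eV (S.tang i₀)))‖ ≤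
      (if i = i₀ then 2 * (S.k + 1) * B * S.η else 0) + 2 * (S.k + 1) * S.a₀ * B' / S.Λ := by
    intro i
    have hu := abs_κ_sub_Θ_le hP hz i
    have hupos : 0 ≤ (S.k + 1) * (S.a₀ * S.η ^ ((i:ℕ) + 1)) :=
      mul_nonneg (by linarith) (mul_nonneg ha₀ (pow_nonneg hP.hη.le _))
    rw [norm_smul, Real.norm_eq_abs]
    refine (mul_le_mul_of_nonneg_left (norm_add_le _ _) (abs_nonneg _)).trans ?_
    rw [mul_add]
    refine add_le_add ?_ ?_
    · -- the `[i = i₀]` term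
      by_cases hi : i = i₀
      · subst hi
        simp only [↓reduceIte]
        rw [norm_smul, Real.norm_eq_abs]
        have hs : |2 / S.a i * Real.sin (S.N i * z (S.tang i))| ≤ 2 / S.a i := by
          rw [abs_mul, abs_of_pos (div_pos two_pos (a_pos hP i))]
          exact mul_le_of_le_one_right (div_pos two_pos (a_pos hP i)).le (Real.abs_sin_le_one _)
        calc |z S.κ - S.Θ i z| * (|2 / S.a i * Real.sin (S.N i * z (S.tang i))| * ‖S.b i z‖)
            ≤ ((S.k + 1) * (S.a₀ * S.η ^ ((i:ℕ) + 1))) * (2 / S.a i * B) :=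
              mul_le_mul hu (mul_le_mul hs (hB i z) (norm_nonneg _) (div_pos two_pos (a_pos hP i)).le)
                (mul_nonneg (abs_nonneg _) (norm_nonneg _)) hupos
          _ = 2 * (S.k + 1) * B * S.η := by
              unfold a
              have hη := hP.hη.ne'
              have ha := hP.ha₀.ne'
              field_simp
              ring
      · simp only [hi, ↓reduceIte, zero_smul, norm_zero, mul_zero, le_refl]
    · -- the `∂b` term
      rw [norm_smul, Real.norm_eq_abs]
      have hs : |-(2 / (S.a i * S.N i)) * Real.cos (S.N i * z (S.tang i))| ≤ 2 / S.Λ := by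
        rw [abs_mul, abs_neg, abs_of_pos (div_pos two_pos (mul_pos (a_pos hP i) (N_pos hP i)))]
        exact (mul_le_of_le_one_right (div_pos two_pos (mul_pos (a_pos hP i) (N_pos hP i))).le
          (Real.abs_cos_le_one _)).trans (two_div_aN_le hP i)
      calc |z S.κ - S.Θ i z| * (|-(2 / (S.a i * S.N i)) * Real.cos (S.N i * z (S.tang i))| *
            ‖fderiv ℝ (S.b i) z (eV (S.tang i₀))‖)
          ≤ ((S.k + 1) * (S.a₀ * S.η ^ ((i:ℕ) + 1))) * (2 / S.Λ * B') :=
            mul_le_mul hu (mul_le_mul hs (hB' i i₀ z) (norm_nonneg _) (div_pos two_pos hΛ).le)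
              (mul_nonneg (abs_nonneg _) (norm_nonneg _)) hupos
        _ ≤ ((S.k + 1) * (S.a₀ * 1)) * (2 / S.Λ * B') :=
            mul_le_mul_of_nonneg_right (mul_le_mul_of_nonneg_left
              (mul_le_mul_of_nonneg_left (ηpow_le_one hP _) ha₀) (by positivity))
              (by positivity)
        _ = 2 * (S.k + 1) * S.a₀ * B' / S.Λ := by ring
  calc ‖∑ i : Fin S.k, (z S.κ - S.Θ i z) •
        ((if i = i₀ then 2 / S.a i * Real.sin (S.N i * z (S.tang i)) else 0) • S.b i z +
          (-(2 / (S.a i * S.N i)) * Real.cos (S.N i * z (S.tang i))) • fderiv ℝ (S.b i) z (eV (S.tang i₀)))‖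
      ≤ ∑ i : Fin S.k, ((if i = i₀ then 2 * (S.k + 1) * B * S.η else 0) + 2 * (S.k + 1) * S.a₀ * B' / S.Λ) :=
        (norm_sum_le _ _).trans (Finset.sum_le_sum fun i _ => hterm i)
    _ = 2 * (S.k + 1) * B * S.η + S.k * (2 * (S.k + 1) * S.a₀ * B' / S.Λ) := by
        rw [Finset.sum_add_distrib, Finset.sum_ite_eq' Finset.univ i₀]
        simp only [Finset.mem_univ, ↓reduceIte, Finset.sum_const, Finset.card_univ, Fintype.card_fin,
          nsmul_eq_mul]
    _ = 2 * (S.k + 1) * B * S.η + 2 * S.k * (S.k + 1) * S.a₀ * B' / S.Λ := by ring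

omit hz hsmall in
/-- The cross terms `[j < i] (2aⱼNⱼ/(aᵢNᵢ)) cos cos bᵢ`. [folklore] -/
theorem T5_le {B : ℝ} (hB0 : 0 ≤ B) (hB : ∀ i z, ‖S.b i z‖ ≤ B) (i₀ : Fin S.k) :
    ‖∑ i : Fin S.k, (if i₀ < i then 2 * (S.a i₀ * S.N i₀) / (S.a i * S.N i) *
          Real.cos (S.N i₀ * z (S.tang i₀)) * Real.cos (S.N i * z (S.tang i)) else 0) • S.b i z‖ ≤
      2 * S.k * S.η * B := by
  have hterm : ∀ i : Fin S.k, ‖(if i₀ < i then 2 * (S.a i₀ * S.N i₀) / (S.a i * S.N i) *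
      Real.cos (S.N i₀ * z (S.tang i₀)) * Real.cos (S.N i * z (S.tang i)) else 0) • S.b i z‖ ≤ 2 * S.η * B := by
    intro i
    by_cases hi : i₀ < i
    · simp only [hi, ↓reduceIte]
      rw [norm_smul, Real.norm_eq_abs]
      have hr : |2 * (S.a i₀ * S.N i₀) / (S.a i * S.N i) *
          Real.cos (S.N i₀ * z (S.tang i₀)) * Real.cos (S.N i * z (S.tang i))| ≤ 2 * S.η := by
        rw [abs_mul, abs_mul, mul_div_assoc, abs_mul, abs_two,
          abs_of_pos (div_pos (mul_pos (a_pos hP i₀) (N_pos hP i₀)) (mul_pos (a_pos hP i) (N_pos hP i)))]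
        calc 2 * (S.a i₀ * S.N i₀ / (S.a i * S.N i)) * |Real.cos (S.N i₀ * z (S.tang i₀))| *
              |Real.cos (S.N i * z (S.tang i))| ≤ 2 * S.η * 1 * 1 := by
              refine mul_le_mul (mul_le_mul (mul_le_mul_of_nonneg_left (aN_div_aN_le hP hi) zero_le_two)
                (Real.abs_cos_le_one _) (abs_nonneg _) (by nlinarith [hP.hη])) (Real.abs_cos_le_one _)
                (abs_nonneg _) (by nlinarith [hP.hη])
          _ = 2 * S.η := by ring
      exact mul_le_mul hr (hB i z) (norm_nonneg _) (by nlinarith [hP.hη])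
    · rw [if_neg hi, zero_smul, norm_zero]
      nlinarith [hP.hη]
  refine (norm_sum_le _ _).trans ((Finset.sum_le_sum fun i _ => hterm i).trans (le_of_eq ?_))
  simp only [Finset.sum_const, Finset.card_univ, Fintype.card_fin, nsmul_eq_mul]; ring

omit hz hsmall in
/-- The terms `(sin(2Nᵢtᵢ)/(2Nᵢ)) ∂ⱼbᵢ`. [folklore] -/
theorem T6_le {B' : ℝ} (hB' : ∀ i j z, ‖fderiv ℝ (S.b i) z (eV (S.tang j))‖ ≤ B')
    (i₀ : Fin S.k) :
    ‖∑ i : Fin S.k, (-(Real.sin (2 * S.N i * z (S.tang i)) / (2 * S.N i))) • fderiv ℝ (S.b i) z (eV (S.tang i₀))‖ ≤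
      S.k * S.a₀ * B' / S.Λ := by
  have hterm : ∀ i : Fin S.k, ‖(-(Real.sin (2 * S.N i * z (S.tang i)) / (2 * S.N i))) •
      fderiv ℝ (S.b i) z (eV (S.tang i₀))‖ ≤ S.a₀ / S.Λ * B' := by
    intro i
    rw [norm_smul, Real.norm_eq_abs, abs_neg, abs_div, abs_mul, abs_two, abs_of_pos (N_pos hP i)]
    have hs : |Real.sin (2 * S.N i * z (S.tang i))| / (2 * S.N i) ≤ S.a₀ / S.Λ := by
      calc |Real.sin (2 * S.N i * z (S.tang i))| / (2 * S.N i) ≤ 1 / (2 * S.N i) :=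
            div_le_div_of_nonneg_right (Real.abs_sin_le_one _) (by linarith [N_pos hP i])
        _ ≤ 1 / S.N i := by
            rw [one_div_le_one_div (by linarith [N_pos hP i]) (N_pos hP i)]; linarith [N_pos hP i]
        _ ≤ S.a₀ / S.Λ := one_div_N_le hP i
    exact mul_le_mul hs (hB' i i₀ z) (norm_nonneg _) (div_nonneg hP.ha₀.le hP.hΛ.le)
  refine (norm_sum_le _ _).trans ((Finset.sum_le_sum fun i _ => hterm i).trans (le_of_eq ?_))
  simp only [Finset.sum_const, Finset.card_univ, Fintype.card_fin, nsmul_eq_mul]; ring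

omit hz hsmall in
/-- `‖Σᵢ cᵢ‖ ≤ 2k B/Λ`. [folklore] -/
theorem sum_c_le {B : ℝ} (hB : ∀ i z, ‖S.b i z‖ ≤ B) :
    ‖∑ i : Fin S.k, S.c i z‖ ≤ 2 * S.k * B / S.Λ := by
  have hterm : ∀ i : Fin S.k, ‖S.c i z‖ ≤ 2 / S.Λ * B := by
    intro i
    unfold c
    rw [norm_smul, Real.norm_eq_abs, abs_mul, abs_neg,
      abs_of_pos (div_pos two_pos (mul_pos (a_pos hP i) (N_pos hP i)))]
    have hs : 2 / (S.a i * S.N i) * |Real.cos (S.N i * z (S.tang i))| ≤ 2 / S.Λ :=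
      (mul_le_of_le_one_right (div_pos two_pos (mul_pos (a_pos hP i) (N_pos hP i))).le
        (Real.abs_cos_le_one _)).trans (two_div_aN_le hP i)
    exact mul_le_mul hs (hB i z) (norm_nonneg _) (div_nonneg zero_le_two hP.hΛ.le)
  refine (norm_sum_le _ _).trans ((Finset.sum_le_sum fun i _ => hterm i).trans (le_of_eq ?_))
  simp only [Finset.sum_const, Finset.card_univ, Fintype.card_fin, nsmul_eq_mul]; ring

/-- **The tangential error estimate.** [folklore] -/
theorem tangential_error_le (hH : Holonomic S) (hf : ContDiff ℝ ∞ S.f) (hA : ContDiff ℝ ∞ S.A)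
    {B B' W' Lf LA : ℝ} (hB0 : 0 ≤ B) (hB : ∀ i z, ‖S.b i z‖ ≤ B)
    (hB'0 : 0 ≤ B') (hB' : ∀ i j z, ‖fderiv ℝ (S.b i) z (eV (S.tang j))‖ ≤ B')
    (hW'0 : 0 ≤ W') (hW' : ∀ l j z, ‖fderiv ℝ (S.w l) z (eV (S.tang j))‖ ≤ W')
    (hLf0 : 0 ≤ Lf) (hLf : ∀ z ∈ {p : EuclideanSpace ℝ (Fin n) | ∀ l, |p l| ≤ 2},
      (∀ j, |z (S.tang j)| ≤ 2) → ‖fderiv ℝ S.f z - fderiv ℝ S.f (S.proj z)‖ ≤ Lf * ‖z - S.proj z‖)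
    (hLA0 : 0 ≤ LA) (hLA : ∀ z ∈ {p : EuclideanSpace ℝ (Fin n) | ∀ l, |p l| ≤ 2},
      (∀ j, |z (S.tang j)| ≤ 2) → ‖S.A z - S.A (S.proj z)‖ ≤ LA * ‖z - S.proj z‖)
    (i₀ : Fin S.k) :
    ‖fderiv ℝ S.g z (eV (S.tang i₀)) - S.A z (eV (S.tang i₀))‖ ≤
      (Lf + LA + W') * (n * ((S.k + 1) * S.a₀)) +
        (2 * (S.k + 1) * B * S.η + 2 * S.k * (S.k + 1) * S.a₀ * B' / S.Λ) +
        2 * S.k * S.η * B + S.k * S.a₀ * B' / S.Λ := by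
  have hN : ∀ i, S.N i ≠ 0 := fun i => (N_pos hP i).ne'
  have ha : ∀ i, S.a i ≠ 0 := fun i => (a_pos hP i).ne'
  -- the exact cancellation of the hidden defect
  have hbi₀ : S.b i₀ z = S.A (S.proj z) (eV (S.tang i₀)) - fderiv ℝ S.f (S.proj z) (eV (S.tang i₀)) := by
    rw [b, χ_eq_one_of_inTube hz, one_smul]
  have hsum1 : ∑ i : Fin S.k, (if i = i₀ then (1:ℝ) else 0) • S.b i z = S.b i₀ z := by
    simp only [ite_smul, one_smul, zero_smul, Finset.sum_ite_eq', Finset.mem_univ, ↓reduceIte]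
  -- decomposition of the error into six terms
  have hrepr : fderiv ℝ S.g z (eV (S.tang i₀)) - S.A z (eV (S.tang i₀)) =
      ((fderiv ℝ S.f z (eV (S.tang i₀)) - fderiv ℝ S.f (S.proj z) (eV (S.tang i₀))) +
        (S.A (S.proj z) (eV (S.tang i₀)) - S.A z (eV (S.tang i₀)))) +
      (∑ l ∈ Finset.univ.filter (fun l : Fin n => S.IsNormal l), z l • fderiv ℝ (S.w l) z (eV (S.tang i₀))) +
      (∑ i : Fin S.k, (z S.κ - S.Θ i z) •
        ((if i = i₀ then 2 / S.a i * Real.sin (S.N i * z (S.tang i)) else 0) • S.b i z +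
          (-(2 / (S.a i * S.N i)) * Real.cos (S.N i * z (S.tang i))) • fderiv ℝ (S.b i) z (eV (S.tang i₀)))) +
      (∑ i : Fin S.k, (if i₀ < i then 2 * (S.a i₀ * S.N i₀) / (S.a i * S.N i) *
          Real.cos (S.N i₀ * z (S.tang i₀)) * Real.cos (S.N i * z (S.tang i)) else 0) • S.b i z) +
      (∑ i : Fin S.k, (-(Real.sin (2 * S.N i * z (S.tang i)) / (2 * S.N i))) • fderiv ℝ (S.b i) z (eV (S.tang i₀))) := by
    rw [fderiv_g_apply_eV_tang' hH hf hA hN ha i₀ z]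
    simp only [Finset.sum_add_distrib]
    rw [hsum1, hbi₀]
    abel
  rw [hrepr]
  have h12 : ‖(fderiv ℝ S.f z (eV (S.tang i₀)) - fderiv ℝ S.f (S.proj z) (eV (S.tang i₀))) +
      (S.A (S.proj z) (eV (S.tang i₀)) - S.A z (eV (S.tang i₀)))‖ ≤ (Lf + LA) * (n * ((S.k + 1) * S.a₀)) := by
    refine (norm_add_le _ _).trans ?_
    rw [add_mul]
    exact add_le_add (lip_f_le hP hz hsmall hLf0 hLf _ (by rw [norm_eV]))
      (lip_A_le hP hz hsmall hLA0 hLA _ (by rw [norm_eV]))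
  have h3 := normal_sum_le hP hz hW'0 hW' i₀
  have h4 := T4_le hP hz hB hB'0 hB' i₀
  have h5 := T5_le hP (z := z) hB0 hB i₀
  have h6 := T6_le hP (z := z) hB' i₀
  -- triangle inequality for six terms
  have tri : ∀ (x₁ x₂ x₃ x₄ x₅ : G), ‖x₁ + x₂ + x₃ + x₄ + x₅‖ ≤ ‖x₁‖ + ‖x₂‖ + ‖x₃‖ + ‖x₄‖ + ‖x₅‖ := by
    intro x₁ x₂ x₃ x₄ x₅
    calc ‖x₁ + x₂ + x₃ + x₄ + x₅‖ ≤ ‖x₁ + x₂ + x₃ + x₄‖ + ‖x₅‖ := norm_add_le _ _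
      _ ≤ ‖x₁ + x₂ + x₃‖ + ‖x₄‖ + ‖x₅‖ := by gcongr; exact norm_add_le _ _
      _ ≤ ‖x₁ + x₂‖ + ‖x₃‖ + ‖x₄‖ + ‖x₅‖ := by gcongr; exact norm_add_le _ _
      _ ≤ ‖x₁‖ + ‖x₂‖ + ‖x₃‖ + ‖x₄‖ + ‖x₅‖ := by gcongr; exact norm_add_le _ _
  refine (tri _ _ _ _ _).trans ?_
  calc _ ≤ (Lf + LA) * (n * ((S.k + 1) * S.a₀)) + n * ((S.k + 1) * S.a₀) * W' +
      (2 * (S.k + 1) * B * S.η + 2 * S.k * (S.k + 1) * S.a₀ * B' / S.Λ) +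
      2 * S.k * S.η * B + S.k * S.a₀ * B' / S.Λ := by gcongr
    _ = _ := by ring

/-- **The normal error estimate** (`l ≥ k`; the `Σcᵢ` term only occurs for `l = k`, but is
harmless in general). [folklore] -/
theorem normal_error_le (hf : ContDiff ℝ ∞ S.f) (hA : ContDiff ℝ ∞ S.A)
    {B Lf LA : ℝ} (hB0 : 0 ≤ B) (hB : ∀ i z, ‖S.b i z‖ ≤ B)
    (hLf0 : 0 ≤ Lf) (hLf : ∀ z ∈ {p : EuclideanSpace ℝ (Fin n) | ∀ l, |p l| ≤ 2},
      (∀ j, |z (S.tang j)| ≤ 2) → ‖fderiv ℝ S.f z - fderiv ℝ S.f (S.proj z)‖ ≤ Lf * ‖z - S.proj z‖)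
    (hLA0 : 0 ≤ LA) (hLA : ∀ z ∈ {p : EuclideanSpace ℝ (Fin n) | ∀ l, |p l| ≤ 2},
      (∀ j, |z (S.tang j)| ≤ 2) → ‖S.A z - S.A (S.proj z)‖ ≤ LA * ‖z - S.proj z‖)
    {l : Fin n} (hl : S.IsNormal l) :
    ‖fderiv ℝ S.g z (eV l) - S.A z (eV l)‖ ≤
      (Lf + LA) * (n * ((S.k + 1) * S.a₀)) + 2 * S.k * B / S.Λ := by
  have hw : S.w l z = S.A (S.proj z) (eV l) - fderiv ℝ S.f (S.proj z) (eV l) := by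
    rw [w, χ_eq_one_of_inTube hz, one_smul]
  have hrepr : fderiv ℝ S.g z (eV l) - S.A z (eV l) =
      ((fderiv ℝ S.f z (eV l) - fderiv ℝ S.f (S.proj z) (eV l)) + (S.A (S.proj z) (eV l) - S.A z (eV l))) +
      (if l = S.κ then ∑ i : Fin S.k, S.c i z else 0) := by
    rw [fderiv_g_apply_eV_of_isNormal hf hA z hl, hw]
    abel
  rw [hrepr]
  have h12 : ‖(fderiv ℝ S.f z (eV l) - fderiv ℝ S.f (S.proj z) (eV l)) +
      (S.A (S.proj z) (eV l) - S.A z (eV l))‖ ≤ (Lf + LA) * (n * ((S.k + 1) * S.a₀)) := by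
    refine (norm_add_le _ _).trans ?_
    rw [add_mul]
    exact add_le_add (lip_f_le hP hz hsmall hLf0 hLf _ (by rw [norm_eV]))
      (lip_A_le hP hz hsmall hLA0 hLA _ (by rw [norm_eV]))
  have hc : ‖(if l = S.κ then ∑ i : Fin S.k, S.c i z else 0)‖ ≤ 2 * S.k * B / S.Λ := by
    split_ifs
    · exact sum_c_le hP hB
    · rw [norm_zero]
      have hk : (0:ℝ) ≤ S.k := Nat.cast_nonneg _
      have := hP.hΛ.le
      positivity
  exact (norm_add_le _ _).trans (add_le_add h12 hc)

omit hsmall in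
/-- **The value estimate** `‖g - f‖` on the tube. [folklore] -/
theorem value_error_le {B W₀ : ℝ} (hB0 : 0 ≤ B) (hB : ∀ i z, ‖S.b i z‖ ≤ B)
    (hW₀0 : 0 ≤ W₀) (hW₀ : ∀ l z, ‖S.w l z‖ ≤ W₀) :
    ‖S.g z - S.f z‖ ≤ n * ((S.k + 1) * S.a₀) * W₀ +
      (2 * S.k * (S.k + 1) * S.a₀ * B / S.Λ + S.k * S.a₀ * B / S.Λ) := by
  have hk : (0:ℝ) ≤ S.k := Nat.cast_nonneg _
  have ha₀ := hP.ha₀.le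
  have hΛ := hP.hΛ
  have hrepr : S.g z - S.f z = (∑ l ∈ Finset.univ.filter (fun l : Fin n => S.IsNormal l), z l • S.w l z) +
      ∑ i : Fin S.k, ((z S.κ - S.Θ i z) • S.c i z + S.d i z) := by
    simp only [g, f₁]; abel
  rw [hrepr]
  have h1 : ‖∑ l ∈ Finset.univ.filter (fun l : Fin n => S.IsNormal l), z l • S.w l z‖ ≤
      n * ((S.k + 1) * S.a₀) * W₀ := by
    calc ‖∑ l ∈ Finset.univ.filter (fun l : Fin n => S.IsNormal l), z l • S.w l z‖
        ≤ ∑ l ∈ Finset.univ.filter (fun l : Fin n => S.IsNormal l), ‖z l • S.w l z‖ := norm_sum_le _ _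
      _ ≤ ∑ l ∈ Finset.univ.filter (fun l : Fin n => S.IsNormal l), (S.k + 1) * S.a₀ * W₀ := by
          refine Finset.sum_le_sum fun l hl => ?_
          rw [norm_smul, Real.norm_eq_abs]
          exact mul_le_mul (abs_normal_le hP hz (Finset.mem_filter.1 hl).2) (hW₀ l z) (norm_nonneg _)
            (mul_nonneg (by linarith) ha₀)
      _ ≤ ∑ _l : Fin n, (S.k + 1) * S.a₀ * W₀ :=
          Finset.sum_le_sum_of_subset_of_nonneg (Finset.filter_subset _ _) fun l _ _ =>
            mul_nonneg (mul_nonneg (by linarith) ha₀) hW₀0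
      _ = n * ((S.k + 1) * S.a₀) * W₀ := by
          simp only [Finset.sum_const, Finset.card_univ, Fintype.card_fin, nsmul_eq_mul]; ring
  have hterm : ∀ i : Fin S.k, ‖(z S.κ - S.Θ i z) • S.c i z + S.d i z‖ ≤
      2 * (S.k + 1) * S.a₀ * B / S.Λ + S.a₀ * B / S.Λ := by
    intro i
    refine (norm_add_le _ _).trans (add_le_add ?_ ?_)
    · rw [norm_smul, Real.norm_eq_abs]
      have hc : ‖S.c i z‖ ≤ 2 / S.Λ * B := by
        unfold c
        rw [norm_smul, Real.norm_eq_abs, abs_mul, abs_neg,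
          abs_of_pos (div_pos two_pos (mul_pos (a_pos hP i) (N_pos hP i)))]
        exact mul_le_mul ((mul_le_of_le_one_right (div_pos two_pos (mul_pos (a_pos hP i) (N_pos hP i))).le
          (Real.abs_cos_le_one _)).trans (two_div_aN_le hP i)) (hB i z) (norm_nonneg _)
          (div_nonneg zero_le_two hΛ.le)
      calc |z S.κ - S.Θ i z| * ‖S.c i z‖ ≤ ((S.k + 1) * (S.a₀ * S.η ^ ((i:ℕ) + 1))) * (2 / S.Λ * B) :=
            mul_le_mul (abs_κ_sub_Θ_le hP hz i) hc (norm_nonneg _)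
              (mul_nonneg (by linarith) (mul_nonneg ha₀ (pow_nonneg hP.hη.le _)))
        _ ≤ ((S.k + 1) * (S.a₀ * 1)) * (2 / S.Λ * B) := by
            gcongr; exact ηpow_le_one hP _
        _ = 2 * (S.k + 1) * S.a₀ * B / S.Λ := by ring
    · unfold d
      rw [norm_smul, Real.norm_eq_abs, abs_mul, abs_neg, abs_of_pos (div_pos one_pos (by linarith [N_pos hP i]))]
      calc 1 / (2 * S.N i) * |Real.sin (2 * S.N i * z (S.tang i))| * ‖S.b i z‖ ≤ S.a₀ / S.Λ * B := by
            refine mul_le_mul ?_ (hB i z) (norm_nonneg _) (div_nonneg ha₀ hΛ.le)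
            calc 1 / (2 * S.N i) * |Real.sin (2 * S.N i * z (S.tang i))| ≤ 1 / (2 * S.N i) :=
                  mul_le_of_le_one_right (div_pos one_pos (by linarith [N_pos hP i])).le (Real.abs_sin_le_one _)
              _ ≤ 1 / S.N i := by
                  rw [one_div_le_one_div (by linarith [N_pos hP i]) (N_pos hP i)]; linarith [N_pos hP i]
              _ ≤ S.a₀ / S.Λ := one_div_N_le hP i
        _ = S.a₀ * B / S.Λ := by ring
  have h2 : ‖∑ i : Fin S.k, ((z S.κ - S.Θ i z) • S.c i z + S.d i z)‖ ≤
      2 * S.k * (S.k + 1) * S.a₀ * B / S.Λ + S.k * S.a₀ * B / S.Λ := by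
    calc ‖∑ i : Fin S.k, ((z S.κ - S.Θ i z) • S.c i z + S.d i z)‖
        ≤ ∑ i : Fin S.k, (2 * (S.k + 1) * S.a₀ * B / S.Λ + S.a₀ * B / S.Λ) :=
          (norm_sum_le _ _).trans (Finset.sum_le_sum fun i _ => hterm i)
      _ = 2 * S.k * (S.k + 1) * S.a₀ * B / S.Λ + S.k * S.a₀ * B / S.Λ := by
          simp only [Finset.sum_const, Finset.card_univ, Fintype.card_fin, nsmul_eq_mul]; ring
  exact (norm_add_le _ _).trans (add_le_add h1 h2)

end Estimates

/-! ### §4 The shear: displacement, derivative, invertibility, and the wiggled cube in the tube -/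

section Shear

/-- **Rank-one perturbations of the identity are invertible**: if `1 + ℓ v ≠ 0` then
`id + v ⊗ ℓ` has the inverse `id - (1 + ℓ v)⁻¹ v ⊗ ℓ`. [folklore] -/
theorem isInvertible_id_add_smulRight {E' : Type*} [NormedAddCommGroup E'] [NormedSpace ℝ E']
    (ℓ : E' →L[ℝ] ℝ) (v : E') (h : 1 + ℓ v ≠ 0) :
    (ContinuousLinearMap.id ℝ E' + ℓ.smulRight v).IsInvertible := by
  obtain ⟨c, hc⟩ : ∃ c : ℝ, c = (1 + ℓ v)⁻¹ := ⟨_, rfl⟩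
  have hcv : c * (1 + ℓ v) = 1 := by rw [hc]; exact inv_mul_cancel₀ h
  have hf : ∀ y, (ContinuousLinearMap.id ℝ E' + ℓ.smulRight v) y = y + ℓ y • v := fun y => rfl
  have hg : ∀ y, (ContinuousLinearMap.id ℝ E' - c • ℓ.smulRight v) y = y - c • (ℓ y • v) := fun y => rfl
  have key : ∀ x, ℓ x - c * (ℓ x + ℓ x * ℓ v) = 0 := fun x => by linear_combination (-(ℓ x)) * hcv
  have key' : ∀ x, ℓ x - c * (ℓ x * ℓ v) - c * ℓ x = 0 := fun x => by linear_combination (-(ℓ x)) * hcv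
  refine ⟨ContinuousLinearEquiv.equivOfInverse (ContinuousLinearMap.id ℝ E' + ℓ.smulRight v)
    (ContinuousLinearMap.id ℝ E' - c • ℓ.smulRight v) (fun x => ?_) (fun x => ?_), rfl⟩
  · rw [hg, hf, map_add, map_smul, smul_eq_mul]
    calc x + ℓ x • v - c • ((ℓ x + ℓ x * ℓ v) • v) = x + (ℓ x - c * (ℓ x + ℓ x * ℓ v)) • v := by module
      _ = x := by rw [key, zero_smul, add_zero]
  · rw [hf, hg, map_sub, map_smul, map_smul, smul_eq_mul, smul_eq_mul]
    calc x - c • (ℓ x • v) + (ℓ x - c * (ℓ x * ℓ v)) • v = x + (ℓ x - c * (ℓ x * ℓ v) - c * ℓ x) • v := by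
          module
      _ = x := by rw [key', zero_smul, add_zero]

/-- The displacement of the shear: `‖h z - z‖ ≤ k a₀`. [folklore] -/
theorem norm_shear_sub_le {S : Setup n G} (hP : S.Params) (z : EuclideanSpace ℝ (Fin n)) :
    ‖S.shear z - z‖ ≤ S.k * S.a₀ := by
  rw [shear, add_sub_cancel_left, norm_smul, norm_eV, mul_one, Real.norm_eq_abs, abs_mul]
  calc |S.Θtot z| * |S.ψ z| ≤ S.k * S.a₀ * 1 :=
        mul_le_mul (abs_Θtot_le hP z) (by rw [abs_of_nonneg (S.ψ_nonneg z)]; exact S.ψ_le_one z)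
          (abs_nonneg _) (by have hk : (0:ℝ) ≤ S.k := Nat.cast_nonneg _; nlinarith [hP.ha₀])
    _ = S.k * S.a₀ := mul_one _

/-- The `κ`-partial of `Θ ψ` is `Θ · ∂_κψ`, and `|∂_κψ| ≤ C` for the derivative bound `C` of
the normal plateau. [folklore] -/
theorem abs_fderiv_Θtot_mul_ψ_le {S : Setup n G} (hP : S.Params) (z : EuclideanSpace ℝ (Fin n)) :
    |fderiv ℝ (fun z => S.Θtot z * S.ψ z) z (eV S.κ)| ≤
      S.k * S.a₀ * Classical.choose (plateau_spec (show (1:ℝ) < 2 by norm_num)).2.2.2.2 := by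
  set C := Classical.choose (plateau_spec (show (1:ℝ) < 2 by norm_num)).2.2.2.2 with hC
  obtain ⟨hC0, hCb⟩ := Classical.choose_spec (plateau_spec (show (1:ℝ) < 2 by norm_num)).2.2.2.2
  -- the line derivative of `ψ` in direction `e_κ`
  have hdiff : DifferentiableAt ℝ (fun z => S.Θtot z * S.ψ z) z :=
    ((S.contDiff_Θtot.mul S.contDiff_ψ).differentiable (by simp)) z
  -- along the line only the factor `β₃(z κ + s)` of `ψ` moves, `Θ` is constant
  have hline : ∀ s : ℝ, S.Θtot (z + s • eV S.κ) * S.ψ (z + s • eV S.κ) =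
      S.Θtot z * (plateau 1 2 (by norm_num) (z S.κ + s) *
        ∏ l ∈ (Finset.univ.filter (fun l : Fin n => S.IsNormal l)).erase S.κ, plateau 1 2 (by norm_num) (z l)) := by
    intro s
    rw [S.Θtot_add_smul_eV_of_isNormal z s S.isNormal_κ]
    congr 1
    unfold ψ
    rw [← Finset.mul_prod_erase _ _ (Finset.mem_filter.2 ⟨Finset.mem_univ _, S.isNormal_κ⟩)]
    congr 1
    · rw [add_smul_eV_apply_self]
    · refine Finset.prod_congr rfl fun l hl => ?_
      rw [add_smul_eV_apply_of_ne _ _ (Finset.ne_of_mem_erase hl)]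
  have hβ : HasDerivAt (fun s : ℝ => plateau 1 2 (by norm_num) (z S.κ + s))
      (deriv (plateau 1 2 (by norm_num)) (z S.κ)) 0 := by
    have h := ((contDiff_plateau (show (1:ℝ) < 2 by norm_num)).differentiable (by simp) (z S.κ + 0)).hasDerivAt
    have := HasDerivAt.comp_const_add (z S.κ) 0 h
    simpa using this
  set P : ℝ := ∏ l ∈ (Finset.univ.filter (fun l : Fin n => S.IsNormal l)).erase S.κ, plateau 1 2 (by norm_num) (z l)
    with hPdef
  have hd : HasDerivAt (fun s : ℝ => S.Θtot (z + s • eV S.κ) * S.ψ (z + s • eV S.κ))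
      (S.Θtot z * (deriv (plateau 1 2 (by norm_num)) (z S.κ) * P)) 0 := by
    have := (hβ.mul_const P).const_mul (S.Θtot z)
    simp only [funext hline]
    exact this
  rw [fderiv_apply_eq_of_hasDerivAt hdiff hd, abs_mul, abs_mul]
  have hprod : |P| ≤ 1 := by
    rw [hPdef, Finset.abs_prod]
    exact Finset.prod_le_one (fun l _ => abs_nonneg _) fun l _ => abs_plateau_le_one _ _
  calc |S.Θtot z| * (|deriv (plateau 1 2 (by norm_num)) (z S.κ)| * |P|)
      ≤ (S.k * S.a₀) * (C * 1) :=
        mul_le_mul (abs_Θtot_le hP z) (mul_le_mul (hCb _) hprod (abs_nonneg _) hC0) (by positivity)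
          (by have hk : (0:ℝ) ≤ S.k := Nat.cast_nonneg _; nlinarith [hP.ha₀])
    _ = S.k * S.a₀ * C := by ring

/-- **The derivative of the shear is everywhere invertible** once `k a₀ C_ψ ≤ 1/2`. [folklore] -/
theorem isInvertible_fderiv_shear {S : Setup n G} (hP : S.Params)
    (hsmallψ : S.k * S.a₀ * Classical.choose (plateau_spec (show (1:ℝ) < 2 by norm_num)).2.2.2.2 ≤ 1 / 2)
    (z : EuclideanSpace ℝ (Fin n)) : (fderiv ℝ S.shear z).IsInvertible := by
  have hφ : DifferentiableAt ℝ (fun z => S.Θtot z * S.ψ z) z :=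
    ((S.contDiff_Θtot.mul S.contDiff_ψ).differentiable (by simp)) z
  have hd : HasFDerivAt S.shear (ContinuousLinearMap.id ℝ _ +
      (fderiv ℝ (fun z => S.Θtot z * S.ψ z) z).smulRight (eV S.κ)) z := by
    unfold shear
    exact (hasFDerivAt_id z).add (hφ.hasFDerivAt.smul_const _)
  rw [hd.fderiv]
  refine isInvertible_id_add_smulRight _ _ ?_
  have := abs_fderiv_Θtot_mul_ψ_le hP z
  have h' : |fderiv ℝ (fun z => S.Θtot z * S.ψ z) z (eV S.κ)| ≤ 1 / 2 := this.trans hsmallψ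
  rw [abs_le] at h'
  linarith [h'.1]

/-- On the cube `K`, the shear raises the wiggle coordinate to `Θ(t)`; the image lies in the
tube. [folklore] -/
theorem shear_mem_tube {S : Setup n G} (hP : S.Params) {z : EuclideanSpace ℝ (Fin n)}
    (ht : ∀ j, |z (S.tang j)| ≤ 1) (hn : ∀ l, S.IsNormal l → z l = 0) : S.InTube (S.shear z) := by
  have hψ : S.ψ z = 1 := S.ψ_eq_one fun l hl => by rw [hn l hl, abs_zero]; exact zero_le_one
  have hsh : S.shear z = z + S.Θtot z • eV S.κ := by rw [shear, hψ, mul_one]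
  have htang : ∀ j, S.shear z (S.tang j) = z (S.tang j) := fun j => by
    rw [hsh, add_smul_eV_apply_of_ne _ _ (S.tang_ne_κ j)]
  refine ⟨fun j => ?_, ?_, fun l hl hlκ => ?_⟩
  · rw [htang]; linarith [ht j, S.hρ]
  · rw [hsh, S.Θtot_add_smul_eV_of_isNormal z _ S.isNormal_κ, add_smul_eV_apply_self, hn _ S.isNormal_κ,
      zero_add, sub_self, abs_zero]
    exact r_pos hP
  · rw [hsh, add_smul_eV_apply_of_ne _ _ hlκ, hn l hl, abs_zero]
    exact r_pos hP

/-- The tube is open. [folklore] -/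
theorem isOpen_tube (S : Setup n G) : IsOpen {z | S.InTube z} := by
  have hc : ∀ l : Fin n, Continuous fun z : EuclideanSpace ℝ (Fin n) => z l :=
    fun l => (contDiff_coord (m := 0) l).continuous
  have hΘ : Continuous S.Θtot := S.contDiff_Θtot.continuous
  have h1 : IsOpen {z : EuclideanSpace ℝ (Fin n) | ∀ j, |z (S.tang j)| < 1 + S.ρ / 4} := by
    simp only [setOf_forall]
    exact isOpen_iInter_of_finite fun j => isOpen_lt (continuous_abs.comp (hc _)) continuous_const
  have h2 : IsOpen {z : EuclideanSpace ℝ (Fin n) | |z S.κ - S.Θtot z| < S.r} :=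
    isOpen_lt (continuous_abs.comp ((hc _).sub hΘ)) continuous_const
  have h3 : IsOpen {z : EuclideanSpace ℝ (Fin n) | ∀ l, S.IsNormal l → l ≠ S.κ → |z l| < S.r} := by
    have : {z : EuclideanSpace ℝ (Fin n) | ∀ l, S.IsNormal l → l ≠ S.κ → |z l| < S.r} =
        ⋂ l ∈ Finset.univ.filter (fun l : Fin n => S.IsNormal l ∧ l ≠ S.κ), {z | |z l| < S.r} := by
      ext z; simp
    rw [this]
    exact isOpen_biInter_finset fun l _ => isOpen_lt (continuous_abs.comp (hc _)) continuous_const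
  have : {z | S.InTube z} = {z : EuclideanSpace ℝ (Fin n) | ∀ j, |z (S.tang j)| < 1 + S.ρ / 4} ∩
      {z | |z S.κ - S.Θtot z| < S.r} ∩ {z | ∀ l, S.IsNormal l → l ≠ S.κ → |z l| < S.r} := by
    ext z; simp only [InTube, mem_setOf_eq, mem_inter_iff, and_assoc]
  rw [this]
  exact (h1.inter h2).inter h3

end Shear


/-! ### §5 Changing the parameters does not change the defects -/

section WithParams

/-- The same data with new parameters `a₀, η, Λ`.
[cite: EliashbergMishachev2002, Thm. 3.1.2 (proof)] -/
def withParams (a₀ η Λ : ℝ) : Setup n G :=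
  { S with a₀ := a₀, η := η, Λ := Λ }

/-- Changing the numerical parameters of a setup (the data `k, f, A, ρ` are kept). [cite:
EliashbergMishachev2002, Thm. 3.1.2 (proof)] -/
@[simp] theorem withParams_k (a₀ η Λ : ℝ) : (S.withParams a₀ η Λ).k = S.k := rfl
/-- Changing the numerical parameters of a setup (the data `k, f, A, ρ` are kept). [cite:
EliashbergMishachev2002, Thm. 3.1.2 (proof)] -/
@[simp] theorem withParams_a₀ (a₀ η Λ : ℝ) : (S.withParams a₀ η Λ).a₀ = a₀ := rfl
/-- Changing the numerical parameters of a setup (the data `k, f, A, ρ` are kept). [cite: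
EliashbergMishachev2002, Thm. 3.1.2 (proof)] -/
@[simp] theorem withParams_η (a₀ η Λ : ℝ) : (S.withParams a₀ η Λ).η = η := rfl
/-- Changing the numerical parameters of a setup (the data `k, f, A, ρ` are kept). [cite:
EliashbergMishachev2002, Thm. 3.1.2 (proof)] -/
@[simp] theorem withParams_Λ (a₀ η Λ : ℝ) : (S.withParams a₀ η Λ).Λ = Λ := rfl
/-- Changing the numerical parameters of a setup (the data `k, f, A, ρ` are kept). [cite:
EliashbergMishachev2002, Thm. 3.1.2 (proof)] -/
@[simp] theorem withParams_ρ (a₀ η Λ : ℝ) : (S.withParams a₀ η Λ).ρ = S.ρ := rfl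
/-- Changing the numerical parameters of a setup (the data `k, f, A, ρ` are kept). [cite:
EliashbergMishachev2002, Thm. 3.1.2 (proof)] -/
@[simp] theorem withParams_f (a₀ η Λ : ℝ) : (S.withParams a₀ η Λ).f = S.f := rfl
/-- Changing the numerical parameters of a setup (the data `k, f, A, ρ` are kept). [cite:
EliashbergMishachev2002, Thm. 3.1.2 (proof)] -/
@[simp] theorem withParams_A (a₀ η Λ : ℝ) : (S.withParams a₀ η Λ).A = S.A := rfl
/-- Changing the numerical parameters of a setup (the data `k, f, A, ρ` are kept). [cite:
EliashbergMishachev2002, Thm. 3.1.2 (proof)] -/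
theorem withParams_tang (a₀ η Λ : ℝ) (i : Fin S.k) : (S.withParams a₀ η Λ).tang i = S.tang i := rfl
/-- Changing the numerical parameters of a setup (the data `k, f, A, ρ` are kept). [cite:
EliashbergMishachev2002, Thm. 3.1.2 (proof)] -/
theorem withParams_proj (a₀ η Λ : ℝ) : (S.withParams a₀ η Λ).proj = S.proj := rfl
/-- Changing the numerical parameters of a setup (the data `k, f, A, ρ` are kept). [cite:
EliashbergMishachev2002, Thm. 3.1.2 (proof)] -/
theorem withParams_b (a₀ η Λ : ℝ) (i : Fin S.k) : (S.withParams a₀ η Λ).b i = S.b i := rfl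
/-- Changing the numerical parameters of a setup (the data `k, f, A, ρ` are kept). [cite:
EliashbergMishachev2002, Thm. 3.1.2 (proof)] -/
theorem withParams_w (a₀ η Λ : ℝ) (l : Fin n) : (S.withParams a₀ η Λ).w l = S.w l := rfl
/-- Changing the numerical parameters of a setup (the data `k, f, A, ρ` are kept). [cite:
EliashbergMishachev2002, Thm. 3.1.2 (proof)] -/
theorem withParams_isNormal (a₀ η Λ : ℝ) (l : Fin n) : (S.withParams a₀ η Λ).IsNormal l ↔ S.IsNormal l :=
  Iff.rfl

end WithParams

/-! ### §6 Real arithmetic of the parameter choice -/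

section Arith

/-- The tangential budget: with `a₀ = η = δ`, `Λ = δ⁻¹`, every term of `tangential_error_le` is
a multiple of `c₁ M δ`, `c₁ = (n + 1)(k + 1)`. [folklore] -/
theorem tangential_budget {n k : ℕ} {B B' W' Lf LA M δ : ℝ} (hB0 : 0 ≤ B) (hB'0 : 0 ≤ B')
    (hM_B : B ≤ M) (hM_B' : B' ≤ M) (hM_W' : W' ≤ M) (hM_Lf : Lf ≤ M) (hM_LA : LA ≤ M)
    (hδ0 : 0 < δ) (hδ1 : δ ≤ 1) (hδk : ((k : ℝ) + 1) * δ ≤ 1) :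
    (Lf + LA + W') * (n * ((k + 1) * δ)) +
        (2 * (k + 1) * B * δ + 2 * k * (k + 1) * δ * B' / (1 / δ)) +
        2 * k * δ * B + k * δ * B' / (1 / δ) ≤
      10 * (((n : ℝ) + 1) * ((k : ℝ) + 1) * M * δ) := by
  have hn : (0:ℝ) ≤ n := Nat.cast_nonneg _
  have hk : (0:ℝ) ≤ k := Nat.cast_nonneg _
  have hM : 0 ≤ M := hB0.trans hM_B
  rw [div_div_eq_mul_div, div_one, div_div_eq_mul_div, div_one]
  -- `k (k+1) δ δ ≤ k δ` from `(k+1) δ ≤ 1`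
  have h1 : (k : ℝ) * (k + 1) * δ * B' * δ ≤ k * δ * B' := by
    have : (k : ℝ) * δ * B' * ((k + 1) * δ) ≤ k * δ * B' * 1 :=
      mul_le_mul_of_nonneg_left hδk (by positivity)
    nlinarith [this]
  have h2 : (k : ℝ) * δ * B' * δ ≤ k * δ * B' := by
    have : (k : ℝ) * δ * B' * δ ≤ k * δ * B' * 1 := mul_le_mul_of_nonneg_left hδ1 (by positivity)
    linarith
  nlinarith [mul_nonneg hn hk, mul_nonneg hn hδ0.le, mul_nonneg hk hδ0.le,
    mul_nonneg (mul_nonneg hn hk) hδ0.le, h1, h2, mul_nonneg hM hδ0.le,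
    mul_nonneg (mul_nonneg hn hM) hδ0.le, mul_nonneg (mul_nonneg hk hM) hδ0.le,
    mul_nonneg (mul_nonneg (mul_nonneg hn hk) hM) hδ0.le]

/-- The normal budget. [folklore] -/
theorem normal_budget {n k : ℕ} {B Lf LA M δ : ℝ} (hB0 : 0 ≤ B)
    (hM_B : B ≤ M) (hM_Lf : Lf ≤ M) (hM_LA : LA ≤ M) (hδ0 : 0 < δ) :
    (Lf + LA) * (n * ((k + 1) * δ)) + 2 * k * B / (1 / δ) ≤ 4 * (((n : ℝ) + 1) * ((k : ℝ) + 1) * M * δ) := by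
  have hn : (0:ℝ) ≤ n := Nat.cast_nonneg _
  have hk : (0:ℝ) ≤ k := Nat.cast_nonneg _
  have hM : 0 ≤ M := hB0.trans hM_B
  rw [div_div_eq_mul_div, div_one]
  nlinarith [mul_nonneg hn hk, mul_nonneg hn hδ0.le, mul_nonneg hk hδ0.le,
    mul_nonneg (mul_nonneg hn hk) hδ0.le, mul_nonneg hM hδ0.le,
    mul_nonneg (mul_nonneg hn hM) hδ0.le, mul_nonneg (mul_nonneg hk hM) hδ0.le,
    mul_nonneg (mul_nonneg (mul_nonneg hn hk) hM) hδ0.le]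

/-- The value budget. [folklore] -/
theorem value_budget {n k : ℕ} {B W₀ M δ : ℝ} (hB0 : 0 ≤ B)
    (hM_B : B ≤ M) (hM_W₀ : W₀ ≤ M) (hδ0 : 0 < δ) (hδ1 : δ ≤ 1) (hδk : ((k : ℝ) + 1) * δ ≤ 1) :
    n * ((k + 1) * δ) * W₀ + (2 * k * (k + 1) * δ * B / (1 / δ) + k * δ * B / (1 / δ)) ≤
      4 * (((n : ℝ) + 1) * ((k : ℝ) + 1) * M * δ) := by
  have hn : (0:ℝ) ≤ n := Nat.cast_nonneg _
  have hk : (0:ℝ) ≤ k := Nat.cast_nonneg _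
  have hM : 0 ≤ M := hB0.trans hM_B
  rw [div_div_eq_mul_div, div_one, div_div_eq_mul_div, div_one]
  have h1 : (k : ℝ) * (k + 1) * δ * B * δ ≤ k * δ * B := by
    have : (k : ℝ) * δ * B * ((k + 1) * δ) ≤ k * δ * B * 1 := mul_le_mul_of_nonneg_left hδk (by positivity)
    nlinarith [this]
  have h2 : (k : ℝ) * δ * B * δ ≤ k * δ * B := by
    have : (k : ℝ) * δ * B * δ ≤ k * δ * B * 1 := mul_le_mul_of_nonneg_left hδ1 (by positivity)
    linarith
  nlinarith [mul_nonneg hn hk, mul_nonneg hn hδ0.le, mul_nonneg hk hδ0.le,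
    mul_nonneg (mul_nonneg hn hk) hδ0.le, h1, h2, mul_nonneg hM hδ0.le,
    mul_nonneg (mul_nonneg hn hM) hδ0.le, mul_nonneg (mul_nonneg hk hM) hδ0.le,
    mul_nonneg (mul_nonneg (mul_nonneg hn hk) hM) hδ0.le]

/-- `k δ C ≤ c₁ M δ` for `C ≤ M`, `M ≥ 0`. [folklore] -/
theorem k_mul_budget {n k : ℕ} {C M δ : ℝ} (hC : C ≤ M) (hM : 0 ≤ M) (hδ0 : 0 ≤ δ) :
    (k : ℝ) * δ * C ≤ ((n : ℝ) + 1) * ((k : ℝ) + 1) * M * δ := by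
  have hn : (0:ℝ) ≤ n := Nat.cast_nonneg _
  have hk : (0:ℝ) ≤ k := Nat.cast_nonneg _
  nlinarith [mul_nonneg hk hδ0, mul_nonneg hn hδ0, mul_nonneg (mul_nonneg hn hk) hδ0,
    mul_nonneg hM hδ0, mul_nonneg (mul_nonneg hn hM) hδ0, mul_nonneg (mul_nonneg hk hM) hδ0,
    mul_nonneg (mul_nonneg (mul_nonneg hn hk) hM) hδ0]

/-- **The choice of `δ`.** [folklore] -/
theorem exists_delta (n k : ℕ) {M ε₁ : ℝ} (hM1 : 1 ≤ M) (hε₁ : 0 < ε₁) (hε₁1 : ε₁ ≤ 1) :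
    ∃ δ : ℝ, 0 < δ ∧ δ ≤ 1 ∧ ((k : ℝ) + 1) * δ ≤ 1 ∧
      10 * (((n : ℝ) + 1) * ((k : ℝ) + 1) * M * δ) ≤ ε₁ / (10 * ((n : ℝ) + 1)) ∧
      4 * (((n : ℝ) + 1) * ((k : ℝ) + 1) * M * δ) ≤ ε₁ / (10 * ((n : ℝ) + 1)) ∧
      4 * (((n : ℝ) + 1) * ((k : ℝ) + 1) * M * δ) ≤ ε₁ ∧
      ((n : ℝ) + 1) * ((k : ℝ) + 1) * M * δ ≤ 1 / 2 ∧
      ((n : ℝ) + 1) * ((k : ℝ) + 1) * M * δ ≤ ε₁ := by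
  have hn : (0:ℝ) ≤ n := Nat.cast_nonneg _
  have hk : (0:ℝ) ≤ k := Nat.cast_nonneg _
  set c₁ : ℝ := ((n : ℝ) + 1) * ((k : ℝ) + 1) with hc₁
  have hc₁n : (n : ℝ) + 1 ≤ c₁ := by rw [hc₁]; nlinarith
  have hc₁1 : 1 ≤ c₁ := by linarith
  have hc₁pos : 0 < c₁ := by linarith
  have hMpos : 0 < M := by linarith
  set δ : ℝ := min (1 / ((k : ℝ) + 1)) (ε₁ / (100 * (c₁ * c₁) * M)) with hδ
  have hδpos : 0 < δ := lt_min (by positivity) (by positivity)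
  have hδk : ((k : ℝ) + 1) * δ ≤ 1 := by
    have : δ ≤ 1 / ((k : ℝ) + 1) := min_le_left _ _
    rwa [le_div_iff₀ (by positivity), mul_comm] at this
  have hδ1 : δ ≤ 1 := by nlinarith
  have hmain : 100 * (c₁ * c₁) * M * δ ≤ ε₁ := by
    have : δ ≤ ε₁ / (100 * (c₁ * c₁) * M) := min_le_right _ _
    rwa [le_div_iff₀ (by positivity), mul_comm] at this
  -- `X := c₁ M δ ≤ ε₁ / (100 c₁)`
  set X : ℝ := c₁ * M * δ with hX
  have hXpos : 0 ≤ X := by positivity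
  have hX1 : 100 * c₁ * X ≤ ε₁ := by rw [hX]; nlinarith
  have hgoal1 : 10 * X ≤ ε₁ / (10 * ((n : ℝ) + 1)) := by
    rw [le_div_iff₀ (by positivity)]; nlinarith
  have hgoal2 : 4 * X ≤ ε₁ / (10 * ((n : ℝ) + 1)) := by linarith
  have hgoal3 : 4 * X ≤ ε₁ := by nlinarith
  have hgoal4 : X ≤ 1 / 2 := by nlinarith
  have hgoal5 : X ≤ ε₁ := by nlinarith
  exact ⟨δ, hδpos, hδ1, hδk, hgoal1, hgoal2, hgoal3, hgoal4, hgoal5⟩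

end Arith

end Setup

/-! ### §7 The theorem -/

/-- **Holonomic approximation over a cube of positive codimension, relative version, for
`1`-jets** (Eliashberg–Mishachev 2002, Thm. 3.1.2 with `K = [-1, 1]ᵏ × 0 ⊂ ℝⁿ`, `k < n`, `L` a
neighbourhood of `∂K` in the coordinate plane; target any real normed space `G`). Let `f, A` be
smooth and `Df = A` at the points of the coordinate `k`-plane with some `|zᵢ| ≥ 1 - ρ` (`i < k`),
`0 < ρ < 1`. Then for every `ε > 0` there are a smooth `g`, a smooth `h : ℝⁿ → ℝⁿ` and an open
`W` with: `h(K) ⊆ W`; `‖g - f‖ ≤ ε` and `‖Dg - A‖ ≤ ε` on `W`; `g = f` where some `|zᵢ| ≥ 1 - ρ`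
(`i < k`) or some `|z_l| ≥ 2` (`l ≥ k`); `h = id` where some `|zᵢ| ≥ 1 - ρ/4` (`i < k`) or some
`|z_l| ≥ 2` (`l ≥ k`); `‖h - id‖ ≤ ε`; `Dh` is invertible everywhere. (`g` is the explicit
wiggled section of `HolonomicApproxWiggle.lean` cut off by the normal plateau `ψ` — which is `1`
on the tube —, `h` the shear, with parameters `a₀ = η = δ`, `Λ = δ⁻¹` for a `δ` determined by
`ε` and the bounds of §1; `W` is the tube.)
[cite: EliashbergMishachev2002, Thm. 3.1.2 (with Thm. 3.1.1, §§3.2–3.7)] -/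
theorem holonomic_approx_cube {k : ℕ} (hk : k < n)
    {f : EuclideanSpace ℝ (Fin n) → G} {A : EuclideanSpace ℝ (Fin n) → (EuclideanSpace ℝ (Fin n) →L[ℝ] G)}
    (hf : ContDiff ℝ ∞ f) (hA : ContDiff ℝ ∞ A) {ρ : ℝ} (hρ : 0 < ρ) (hρ1 : ρ < 1)
    (hol : ∀ z : EuclideanSpace ℝ (Fin n), (∀ l : Fin n, k ≤ l.val → z l = 0) →
      (∃ i : Fin n, i.val < k ∧ 1 - ρ ≤ |z i|) → fderiv ℝ f z = A z)
    {ε : ℝ} (hε : 0 < ε) :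
    ∃ (g : EuclideanSpace ℝ (Fin n) → G) (h : EuclideanSpace ℝ (Fin n) → EuclideanSpace ℝ (Fin n))
      (W : Set (EuclideanSpace ℝ (Fin n))),
      ContDiff ℝ ∞ g ∧ ContDiff ℝ ∞ h ∧ IsOpen W ∧
      (∀ z, (∀ i : Fin n, i.val < k → |z i| ≤ 1) → (∀ l : Fin n, k ≤ l.val → z l = 0) → h z ∈ W) ∧
      (∀ z ∈ W, ‖g z - f z‖ ≤ ε) ∧ (∀ z ∈ W, ‖fderiv ℝ g z - A z‖ ≤ ε) ∧
      (∀ z, (∃ i : Fin n, i.val < k ∧ 1 - ρ ≤ |z i|) → g z = f z) ∧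
      (∀ z, (∃ l : Fin n, k ≤ l.val ∧ 2 ≤ |z l|) → g z = f z) ∧
      (∀ z z₀ : EuclideanSpace ℝ (Fin n), (∀ i : Fin n, i.val < k → z₀ i = z i) →
        (∀ l : Fin n, k ≤ l.val → z₀ l = 0) → fderiv ℝ f z₀ = A z₀ → g z = f z) ∧
      (∀ z, (∃ i : Fin n, i.val < k ∧ 1 - ρ / 4 ≤ |z i|) → h z = z) ∧
      (∀ z, (∃ l : Fin n, k ≤ l.val ∧ 2 ≤ |z l|) → h z = z) ∧
      (∀ z (l : Fin n), l.val ≠ k → h z l = z l) ∧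
      (∀ z ∈ W, (∀ i : Fin n, i.val < k → |z i| < 1 + ρ / 4) ∧ (∀ l : Fin n, k ≤ l.val → |z l| ≤ ε)) ∧
      (∀ z, ‖h z - z‖ ≤ ε) ∧ (∀ z, (fderiv ℝ h z).IsInvertible) := by
  -- the parameter-free data and its bounds
  let S₀ : Setup n G := ⟨k, hk, f, A, ρ, hρ, hρ1, 1, 1, 1⟩
  obtain ⟨B, hB0, hB⟩ := Setup.exists_bound_b (S := S₀) hf hA
  obtain ⟨B', hB'0, hB'⟩ := Setup.exists_bound_fderiv_b (S := S₀) hf hA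
  obtain ⟨W₀, hW₀0, hW₀⟩ := Setup.exists_bound_w (S := S₀) hf hA
  obtain ⟨W', hW'0, hW'⟩ := Setup.exists_bound_fderiv_w (S := S₀) hf hA
  obtain ⟨Lf, hLf0, hLf⟩ := S₀.exists_lipschitz_proj (F := fderiv ℝ f)
    (hf.fderiv_right (m := 1) (WithTop.coe_le_coe.mpr le_top))
  obtain ⟨LA, hLA0, hLA⟩ := S₀.exists_lipschitz_proj (F := A) (hA.of_le (WithTop.coe_le_coe.mpr le_top))
  obtain ⟨hCψ0, hCψ⟩ := Classical.choose_spec (plateau_spec (show (1:ℝ) < 2 by norm_num)).2.2.2.2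
  set Cψ := Classical.choose (plateau_spec (show (1:ℝ) < 2 by norm_num)).2.2.2.2 with hCψdef
  -- the constants and `δ`
  set M : ℝ := B + B' + W₀ + W' + Lf + LA + Cψ + 1 with hM
  have hM_B : B ≤ M := by rw [hM]; linarith
  have hM_B' : B' ≤ M := by rw [hM]; linarith
  have hM_W₀ : W₀ ≤ M := by rw [hM]; linarith
  have hM_W' : W' ≤ M := by rw [hM]; linarith
  have hM_Lf : Lf ≤ M := by rw [hM]; linarith
  have hM_LA : LA ≤ M := by rw [hM]; linarith
  have hM_C : Cψ ≤ M := by rw [hM]; linarith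
  have hM1 : 1 ≤ M := by rw [hM]; linarith
  have hM0 : 0 ≤ M := by linarith
  set ε₁ : ℝ := min ε 1 with hε₁
  have hε₁pos : 0 < ε₁ := lt_min hε one_pos
  have hε₁ε : ε₁ ≤ ε := min_le_left _ _
  have hε₁1 : ε₁ ≤ 1 := min_le_right _ _
  obtain ⟨δ, hδpos, hδ1, hδk, hbud10, hbud4', hbud4, hbudhalf, hbud1⟩ := Setup.exists_delta n k hM1 hε₁pos hε₁1
  have hn0 : (0:ℝ) ≤ n := Nat.cast_nonneg _
  have hn1 : ε₁ / (10 * ((n : ℝ) + 1)) ≤ ε₁ := by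
    rw [div_le_iff₀ (by positivity)]; nlinarith
  -- the data with the chosen parameters
  let S : Setup n G := S₀.withParams δ δ (1 / δ)
  have hP : S.Params := ⟨hδpos, hδpos, hδ1, by show (0:ℝ) < 1 / δ; positivity⟩
  have hBS : ∀ i z, ‖S.b i z‖ ≤ B := fun i z => by
    rw [show S.b i = S₀.b i from S₀.withParams_b _ _ _ i]; exact hB i z
  have hB'S : ∀ i j z, ‖fderiv ℝ (S.b i) z (eV (S.tang j))‖ ≤ B' := fun i j z => by
    rw [show S.b i = S₀.b i from S₀.withParams_b _ _ _ i]; exact hB' i j z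
  have hW₀S : ∀ l z, ‖S.w l z‖ ≤ W₀ := fun l z => by
    rw [show S.w l = S₀.w l from S₀.withParams_w _ _ _ l]; exact hW₀ l z
  have hW'S : ∀ l j z, ‖fderiv ℝ (S.w l) z (eV (S.tang j))‖ ≤ W' := fun l j z => by
    rw [show S.w l = S₀.w l from S₀.withParams_w _ _ _ l]; exact hW' l j z
  have hLfS : ∀ z ∈ {p : EuclideanSpace ℝ (Fin n) | ∀ l, |p l| ≤ 2},
      (∀ j, |z (S.tang j)| ≤ 2) → ‖fderiv ℝ S.f z - fderiv ℝ S.f (S.proj z)‖ ≤ Lf * ‖z - S.proj z‖ := hLf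
  have hLAS : ∀ z ∈ {p : EuclideanSpace ℝ (Fin n) | ∀ l, |p l| ≤ 2},
      (∀ j, |z (S.tang j)| ≤ 2) → ‖S.A z - S.A (S.proj z)‖ ≤ LA * ‖z - S.proj z‖ := hLA
  have hH : Setup.Holonomic S := by
    intro z hz hi
    obtain ⟨i, hi⟩ := hi
    exact hol z (fun l hl => hz l hl) ⟨S.tang i, i.isLt, hi⟩
  have hsmall : (S.k + 1) * S.a₀ ≤ 1 := hδk
  have hkC : (S.k : ℝ) * S.a₀ * Cψ ≤ ((n : ℝ) + 1) * ((k : ℝ) + 1) * M * δ := Setup.k_mul_budget hM_C hM0 hδpos.le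
  have hsmallψ : S.k * S.a₀ * Classical.choose (plateau_spec (show (1:ℝ) < 2 by norm_num)).2.2.2.2 ≤ 1 / 2 :=
    hkC.trans hbudhalf
  -- the three error estimates, on the tube
  have htan : ∀ {z} (_ : S.InTube z) (i₀ : Fin S.k),
      ‖fderiv ℝ S.g z (eV (S.tang i₀)) - S.A z (eV (S.tang i₀))‖ ≤ ε₁ / (10 * ((n : ℝ) + 1)) := by
    intro z hz i₀
    have h := Setup.tangential_error_le hP hz hsmall hH hf hA hB0 hBS hB'0 hB'S hW'0 hW'S hLf0 hLfS hLA0 hLAS i₀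
    have hb := Setup.tangential_budget (n := n) (k := k) hB0 hB'0 hM_B hM_B' hM_W' hM_Lf hM_LA hδpos hδ1 hδk
    exact h.trans (hb.trans hbud10)
  have hnor : ∀ {z} (_ : S.InTube z) {l : Fin n} (_ : S.IsNormal l),
      ‖fderiv ℝ S.g z (eV l) - S.A z (eV l)‖ ≤ ε₁ / (10 * ((n : ℝ) + 1)) := by
    intro z hz l hl
    have h := Setup.normal_error_le hP hz hsmall hf hA hB0 hBS hLf0 hLfS hLA0 hLAS hl
    have hb := Setup.normal_budget (n := n) (k := k) hB0 hM_B hM_Lf hM_LA hδpos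
    exact h.trans (hb.trans hbud4')
  have hval : ∀ {z} (_ : S.InTube z), ‖S.g z - S.f z‖ ≤ ε := by
    intro z hz
    have h := Setup.value_error_le hP hz hB0 hBS hW₀0 hW₀S
    have hb := Setup.value_budget (n := n) (k := k) hB0 hM_B hM_W₀ hδpos hδ1 hδk
    exact h.trans (hb.trans (hbud4.trans hε₁ε))
  -- the operator norm from the partials
  have hop : ∀ {z} (_ : S.InTube z), ‖fderiv ℝ S.g z - S.A z‖ ≤ ε := by
    intro z hz
    have hdir : ∀ i : Fin n, ‖(fderiv ℝ S.g z - S.A z) (eV i)‖ ≤ ε₁ / (10 * ((n : ℝ) + 1)) := by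
      intro i
      rw [show (fderiv ℝ S.g z - S.A z) (eV i) = fderiv ℝ S.g z (eV i) - S.A z (eV i) from rfl]
      by_cases hl : S.IsNormal i
      · exact hnor hz hl
      · have hlt : i.val < k := not_le.1 hl
        have hi : i = S.tang ⟨i.val, hlt⟩ := Fin.ext rfl
        rw [hi]
        exact htan hz _
    refine (opNorm_le_mul_of_forall_norm_apply_eV_le _ hdir).trans ?_
    calc (n : ℝ) * (ε₁ / (10 * ((n : ℝ) + 1))) ≤ ε₁ := by
          rw [mul_div_assoc', div_le_iff₀ (by positivity)]; nlinarith
      _ ≤ ε := hε₁ε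
  -- the normal cutoff of the section (`ψ = 1` on the tube)
  have hψW : ∀ {z} (_ : S.InTube z), S.ψ z = 1 := fun {z} hz =>
    S.ψ_eq_one fun l hl => (Setup.abs_normal_le hP hz hl).trans hsmall
  set g' : EuclideanSpace ℝ (Fin n) → G := fun z => f z + S.ψ z • (S.g z - f z) with hg'
  have hg's : ContDiff ℝ ∞ g' := hf.add (S.contDiff_ψ.smul ((Setup.contDiff_g hf hA).sub hf))
  have hg'W : ∀ {z} (_ : S.InTube z), g' z = S.g z := fun {z} hz => by
    simp only [hg', hψW hz, one_smul]; abel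
  have hg'ev : ∀ {z} (_ : S.InTube z), g' =ᶠ[𝓝 z] S.g := fun {z} hz => by
    filter_upwards [S.isOpen_tube.mem_nhds hz] with z' hz'
    exact hg'W hz'
  -- assembling
  refine ⟨g', S.shear, {z | S.InTube z}, hg's, S.contDiff_shear, S.isOpen_tube,
    fun z ht hn => ?_, fun z hz => ?_, fun z hz => ?_, fun z hz => ?_, fun z hz => ?_,
    fun z z₀ ht hn hz₀ => ?_, fun z hz => ?_, fun z hz => ?_,
    fun z l hl => S.shear_apply_of_ne z (fun h => hl (by rw [h]; rfl)), fun z hz => ⟨?_, ?_⟩,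
    fun z => ?_, fun z => Setup.isInvertible_fderiv_shear hP hsmallψ z⟩
  · -- the wiggled cube lies in the tube
    exact Setup.shear_mem_tube hP (fun j => ht (S.tang j) j.isLt) (fun l hl => hn l hl)
  · -- values
    rw [hg'W hz]; exact hval hz
  · -- derivatives
    rw [(hg'ev hz).fderiv_eq]; exact hop hz
  · -- `g = f` on the rim
    obtain ⟨i, hik, hi⟩ := hz
    have hgf : S.g z = f z :=
      Setup.g_eq_of_rim hH ⟨⟨i.val, hik⟩, by rw [show S.tang ⟨i.val, hik⟩ = i from Fin.ext rfl]; exact hi⟩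
    simp only [hg', hgf, sub_self, smul_zero, add_zero]
  · -- `g = f` off the normal cutoff
    obtain ⟨l, hlk, hl⟩ := hz
    simp only [hg', S.ψ_eq_zero ⟨l, hlk, hl⟩, zero_smul, add_zero]
  · -- `g = f` wherever `Df = A` at the projection (pointwise relative property)
    have hπ : z₀ = S.proj z :=
      S.eq_proj_of_forall (fun j => ht (S.tang j) j.isLt) (fun l hl => hn l hl)
    have hgf : S.g z = f z := S.g_eq_of_fderiv_proj_eq (by rw [← hπ]; exact hz₀)
    simp only [hg', hgf, sub_self, smul_zero, add_zero]
  · -- `h = id` near `∂K`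
    obtain ⟨i, hik, hi⟩ := hz
    exact S.shear_eq_of_rim ⟨⟨i.val, hik⟩, by rw [show S.tang ⟨i.val, hik⟩ = i from Fin.ext rfl]; exact hi⟩
  · -- `h = id` off the normal cutoff
    obtain ⟨l, hlk, hl⟩ := hz
    exact S.shear_eq_of_ψ_eq_zero (S.ψ_eq_zero ⟨l, hlk, hl⟩)
  · -- tangential extent of the tube
    exact fun i hi => hz.1 ⟨i.val, hi⟩
  · -- normal thickness of the tube
    intro l hl
    have h1 : |z l| ≤ (S.k + 1) * S.a₀ := Setup.abs_normal_le hP hz hl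
    have h2 : ((S.k : ℝ) + 1) * S.a₀ ≤ ε := by
      show ((k : ℝ) + 1) * δ ≤ ε
      have hc₁ : (k : ℝ) + 1 ≤ (n + 1) * (k + 1) * M := by
        have hk0 : (0 : ℝ) ≤ k := Nat.cast_nonneg _
        clear * - hk0 hM1 hn0
        nlinarith [hM1, hn0, mul_nonneg hn0 hk0, mul_nonneg (mul_nonneg hn0 hk0) (by linarith : (0:ℝ) ≤ M)]
      have h3 : ((k : ℝ) + 1) * δ ≤ (n + 1) * (k + 1) * M * δ :=
        mul_le_mul_of_nonneg_right hc₁ hδpos.le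
      clear * - h3 hbud1 hε₁ε
      linarith
    exact h1.trans h2
  · -- `‖h - id‖ ≤ ε`
    refine (Setup.norm_shear_sub_le hP z).trans ?_
    have : (S.k : ℝ) * S.a₀ ≤ ((n : ℝ) + 1) * ((k : ℝ) + 1) * M * δ := by
      have := Setup.k_mul_budget (n := n) (k := k) (C := 1) hM1 hM0 hδpos.le
      show (k : ℝ) * δ ≤ _
      simpa using this
    exact this.trans (hbud1.trans hε₁ε)

end Literature.Topology.Immersions.HolonomicApprox
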